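import Literature.NumberTheory.LFunctions.BondarenkoHeap2026Sections3to5
import Literature.NumberTheory.LFunctions.BondarenkoHeap2026Section2Proofs
import Literature.NumberTheory.Sieve.FordAsymptoticSievePrimeSums
import Literature.NumberTheory.LFunctions.MertensElementary
import Literature.NumberTheory.LFunctions.PrimeNumberTheoremErrorTermProofs
import Literature.NumberTheory.LFunctions.RudnickSarnakNPrimeSums
import Mathlib.Analysis.SpecialFunctions.Trigonometric.Sinc
import Mathlib.Analysis.Calculus.MeanValue
import Mathlib.Analysis.SpecialFunctions.Pow.Real
import Mathlib.Analysis.SumIntegralComparisons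
import Mathlib.NumberTheory.Harmonic.Bounds
import Mathlib.Algebra.BigOperators.Module
import Mathlib.MeasureTheory.Integral.IntervalIntegral.FundThmCalculus
import HarnessLib

/-!
# Bondarenko–Heap 2026: Lemma 4 from (14), (18) PROVED, and Proposition 5 from (17) + Proposition 3

LABEL (C5 / rh-crit-ah, LADDER-RH §4 HELD «conditional bridges: exceptional zero ⇒ …»):
**NOT RH-BEARING.** RH-FREE literature: this module PROVES the implication
`eq14 → lemma4` of `BondarenkoHeap2026Sections3to5` — Bondarenko–Heap's Lemma 4 (the completion
lemma for `∑_m V(m)χ(m)χ(km + r)` against a smooth dyadic weight) follows from their pointwise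
bounds (14) for the complete sums `S_q(k, r; b)` exactly as printed (arXiv:2608.07399v1, §4,
proof of Lemma 4, p. 10–11; TeX l.507–552): "We first complete the sum … (13) … In the first term
of (13) we have `∑ V = ∫ V + O(q^ε) ≪ q^ε M` whilst, by partial summation, the second term is
`≪ ‖V‖_BV ∑_{b=1}^{q−1} |S_q(k,r;b)|/(q‖b/q‖)` since `∑_{n ⩽ t} e(bn/q) ≪ 1/‖b/q‖` … Summing over
`b` and using `(r, b, Q) ⩽ (r, Q)` and `∑_{b ⩽ q−1} (q‖b/q‖)^{−1} ≪ log q` gives the result."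
No `ζ`, no `RiemannHypothesis`; nothing here bears on the truth of RH. After this file the node
BH26:Lem4 is a theorem MODULO the single named fact `eq14` ((14): Gauss sums / Weil's bound).

Second part (appended): the display **(18)** of the proof of Proposition 5 — "the prime number theorem
and partial summation give `∑_{p ⩽ L} (1/p) C_G(log p/log L) sin(πc log p/log T) ∼ ∫₀¹ C_G(u) sin(πcϑu)/u du`"
(TeX l.683–689) — is DISCHARGED: `eq18_holds : eq18`, from the tree's de la Vallée Poussin prime
number theorem (`ChebyshevThetaDeLaValleePoussin_holds`) through Ford's packaged partial-summation
lemma `Sieve.Ford2004.longSum_est` (with `x = q^{17/12}`, `t_p = 2 log p/log L`, and the Lipschitz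
weight `F(t) = cutoff_ε(t)·C_G(t/2) sin(πcϑt/2)/t`), Mertens' bound `MertensBound.sum_log_div_prime_le`
for the primes `p ⩽ L^ε`, and the substitution `∫₀² C_G(t/2) sin(πcϑt/2)/t dt = ∫₀¹ C_G(u) sin(πcϑu)/u du`.

Third part (appended): **Proposition 5** (the diagonal terms `𝒟`) is PROVED from the named facts (17)
(`eq17`, the inner `m`-sum) and Proposition 3 (`prop3`, Heath-Brown), with (18) (`eq18_holds`) and (3)
(`cPhi_pos`, `weightHat_zero`): `prop5_of_eq17_prop3`, following the printed proof (§5, pp. 13–14,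
TeX l.655–700) step by step — "taking `km = n`" (`diagD_eq_sum`), the inner sum at a prime
(`innerSum_prime`: `χ` real, `χ(m)² = 1_{(m,q)=1}`, `Λ(p)g_h(p) = sin(πc log p/log T)`), "the
contribution from prime powers is negligible" (`nonprime_part_le`, via the tree's
`RudnickSarnakN.sum_vonMangoldt_div_self_not_prime_le`), the accumulated `O((log log q)²)` error of
(17) against `φ(q)/q ≫ 1/log log q` (tree `MertensBound.exists_lt_totient_div_self`), and "replacing
`χ(p)` by `−1`" (`badPrimes_le`: primes `p ∣ q` cost `≤ log log q + log 4 + 1`, primes with `χ(p) = 1`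
are mimicry primes `≤ L < q^{500}`, bounded by Proposition 3).

## Contents (all PROVED)

* `four_mul_min_div_le_norm_stdAddChar_sub_one`: `4 min(b, q − b)/q ≤ ‖e(b/q) − 1‖`
  (`‖e(t) − 1‖ = 2|sin πt|`, `sin x ≥ (2/π)x` on `[0, π/2]`) — the quantitative "`1/‖b/q‖`".
* `norm_sum_stdAddChar_le`: `‖∑_{1 ≤ j ≤ m} e(bj/q)‖ ≤ 2/‖e(b/q) − 1‖` (`b ≢ 0`).
* `norm_sum_mul_le_of_partial_sums`: Abel summation against bounded partial sums.
* `norm_le_iSup_norm`, `sum_norm_sub_le_integral`: for a smooth compactly supported weight,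
  `‖V(x)‖ ≤ ‖V‖_∞` and `∑_i ‖V(i+2) − V(i+1)‖ ≤ ∫ ‖V′‖` (so the partial-summation loss is
  `≤ ‖V‖_BV`).
* `sum_inv_norm_stdAddChar_sub_one_le`, `sum_erase_zero_inv_norm_stdAddChar_sub_one_le`:
  `∑_{b=1}^{q−1} 1/‖e(b/q) − 1‖ ≤ (q/2)(1 + log q)` (harmonic sum).
* `lemma4_of_eq14 : eq14 → lemma4`, with `δ = ε/3` and `C = C₁₄(ε/3) · A² · (2 + 3/ε)` (the
  `log q` is absorbed by `1 + log q ≤ (1 + 3/ε) q^{ε/3}`).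
* `continuous_cG`, `cG_bound_lipschitz` (`C_G` is continuous, bounded and Lipschitz on `[0,1]`),
  the private weight construction (`clampI`, `cutoff`, `gProfile`, `fordWeight` and their
  properties), `eq18_holds_aux` and `eq18_holds : eq18`.
* `diagD_eq_sum`, `innerSum_prime`, `nonprime_part_le`, `sum_abs_sin_div_le`, `badPrimes_le`,
  `exists_G_bound`, `weightHat_zero_lower`, `prop5_of_eq17_prop3_aux` (all inputs as hypotheses),
  `prop5_of_eq17_prop3 : eq17 → prop3 → prop5` and `theorem4_of_eq17_prop3_prop6` ((3) and (18)
  being discharged by `Section2Proofs` and this file).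

## References

* [BondarenkoHeap2026] A. Bondarenko, W. Heap, arXiv:2608.07399v1, §4, Lemma 4 and its proof
  ((13), (14)), pp. 10–11; §5 Proposition 5 and its proof ((17), (18)), pp. 13–14.
* [RudnickSarnak1996] Lemma 3.8 (tree `RudnickSarnakN.sum_vonMangoldt_div_self_not_prime_le`: the
  proper prime powers contribute `≤ 7` to `Σ Λ(n)/n`); [HardyWright2008] Thm 328 (tree
  `MertensBound.exists_lt_totient_div_self`: `φ(n)/n ≫ 1/log log n`).
* [Ford2004] K. Ford's Lemma 2.2 (tree `Sieve.Ford2004.longSum_est`); [MontgomeryVaughan2007]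
  Theorem 6.9 (tree `ChebyshevThetaDeLaValleePoussin_holds`); [HardyWright2008] Thm 425 (tree
  `MertensBound.sum_log_div_prime_le`).
-/

noncomputable section

open Finset Real Complex
open scoped ContDiff

namespace Literature.NumberTheory.LFunctions.BondarenkoHeap2026

/-! ### §4. Lemma 4 from (13) + (14) + partial summation (PROVED implication) -/

section Lemma4Proof

open MeasureTheory intervalIntegral

/-- `‖e(x) − 1‖ ≥ 4 min(t, 1 − t)` for `x = b/q`, in the form used for the geometric sums:
for `0 < b < q`, `4 · min(b, q − b)/q ≤ ‖e(b/q) − 1‖` (`‖e(t) − 1‖ = 2|sin πt|` and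
`sin x ≥ (2/π) x` on `[0, π/2]`). [cite: BondarenkoHeap2026, §4 (proof of Lemma 4)] -/
theorem four_mul_min_div_le_norm_stdAddChar_sub_one {q : ℕ} [NeZero q] {b : ℕ} (hb0 : 0 < b)
    (hbq : b < q) :
    4 * (min (b : ℝ) (q - b)) / q ≤ ‖ZMod.stdAddChar ((b : ℤ) : ZMod q) - 1‖ := by
  have hq0 : (0 : ℝ) < q := by exact_mod_cast lt_trans hb0 hbq
  rw [ZMod.stdAddChar_coe]
  have hrw : Complex.exp (2 * π * I * (b : ℤ) / q) = Complex.exp (I * ((2 * π * b / q : ℝ) : ℂ)) := by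
    congr 1; push_cast; ring
  rw [hrw, Complex.norm_exp_I_mul_ofReal_sub_one]
  have harg : (2 * π * b / q : ℝ) / 2 = π * (b / q) := by ring
  rw [harg, Real.norm_eq_abs]
  -- `sin(π t) ≥ 2 min(t, 1-t)` for `t = b/q ∈ (0,1)`
  have ht0 : (0 : ℝ) < b / q := by positivity
  have ht1 : (b : ℝ) / q < 1 := by rw [div_lt_one hq0]; exact_mod_cast hbq
  have key : 2 * min ((b : ℝ) / q) (1 - b / q) ≤ Real.sin (π * (b / q)) := by
    by_cases hhalf : (b : ℝ) / q ≤ 1 / 2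
    · have h1 : π * (b / q) ≤ π / 2 := by nlinarith [Real.pi_pos]
      have := Real.mul_le_sin (by positivity) h1
      calc 2 * min ((b : ℝ) / q) (1 - b / q) ≤ 2 * (b / q) := by
              gcongr; exact min_le_left _ _
        _ = 2 / π * (π * (b / q)) := by field_simp
        _ ≤ Real.sin (π * (b / q)) := this
    · push Not at hhalf
      have h1 : π * (1 - b / q) ≤ π / 2 := by nlinarith [Real.pi_pos]
      have h2 : 0 ≤ π * (1 - b / q) := by nlinarith [Real.pi_pos]
      have := Real.mul_le_sin h2 h1
      rw [show π * (1 - b / q) = π - π * (b / q) by ring, Real.sin_pi_sub] at this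
      calc 2 * min ((b : ℝ) / q) (1 - b / q) ≤ 2 * (1 - b / q) := by
              gcongr; exact min_le_right _ _
        _ = 2 / π * (π - π * (b / q)) := by field_simp
        _ ≤ Real.sin (π * (b / q)) := this
  have hmin : min ((b : ℝ) / q) (1 - b / q) = min (b : ℝ) (q - b) / q := by
    rw [show (1 : ℝ) - b / q = (q - b) / q by field_simp, min_div_div_right (le_of_lt hq0)]
  calc 4 * min (b : ℝ) (q - b) / q = 2 * (2 * min ((b : ℝ) / q) (1 - b / q)) := by
        rw [hmin]; ring
    _ ≤ 2 * Real.sin (π * (b / q)) := by linarith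
    _ ≤ |2 * Real.sin (π * (b / q))| := le_abs_self _

/-- The geometric sums `E_b(m) = ∑_{1 ≤ j ≤ m} e(bj/q)` are bounded by `2/‖e(b/q) − 1‖` for
`b ≢ 0 (mod q)`. [cite: BondarenkoHeap2026, §4 (proof of Lemma 4)] -/
theorem norm_sum_stdAddChar_le {q : ℕ} [NeZero q] {b : ZMod q} (hb : b ≠ 0) (m : ℕ) :
    ‖∑ j ∈ Finset.range m, ZMod.stdAddChar (b * ((j + 1 : ℕ) : ZMod q))‖ ≤
      2 / ‖ZMod.stdAddChar b - 1‖ := by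
  set w : ℂ := ZMod.stdAddChar b with hw
  have hw1 : w ≠ 1 := by
    intro h
    apply hb
    have h' : ZMod.stdAddChar b = ZMod.stdAddChar (0 : ZMod q) := by
      rw [AddChar.map_zero_eq_one]; exact h
    exact ZMod.injective_stdAddChar h'
  have hnorm : ‖w‖ = 1 := by rw [hw, ZMod.stdAddChar_apply]; exact Circle.norm_coe _
  have hterm : ∀ j : ℕ, ZMod.stdAddChar (b * ((j + 1 : ℕ) : ZMod q)) = w ^ (j + 1) := by
    intro j
    rw [← AddChar.map_nsmul_eq_pow, nsmul_eq_mul, mul_comm]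
  simp_rw [hterm]
  have hgeom : ∑ j ∈ Finset.range m, w ^ (j + 1) = w * ((w ^ m - 1) / (w - 1)) := by
    rw [← geom_sum_eq hw1 m, Finset.mul_sum]
    refine Finset.sum_congr rfl fun j _ => ?_
    ring
  rw [hgeom, norm_mul, hnorm, one_mul, norm_div]
  have hden : 0 < ‖w - 1‖ := norm_pos_iff.mpr (sub_ne_zero.mpr hw1)
  refine div_le_div_of_nonneg_right ?_ hden.le
  calc ‖w ^ m - 1‖ ≤ ‖w ^ m‖ + ‖(1 : ℂ)‖ := norm_sub_le _ _
    _ = 2 := by rw [norm_pow, hnorm, one_pow, norm_one]; norm_num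

/-- **Partial summation against a weight of bounded variation**: if all partial sums
`∑_{j<k} g(j)` have norm `≤ B`, then `‖∑_{i<n} f(i+1) g(i)‖ ≤ B (‖f n‖ + ∑_{i<n-1} ‖f(i+2) − f(i+1)‖)`.
[cite: BondarenkoHeap2026, §4 (proof of Lemma 4)] -/
theorem norm_sum_mul_le_of_partial_sums (f : ℕ → ℂ) (g : ℕ → ℂ) (n : ℕ) {B : ℝ}
    (hB : ∀ k ≤ n, ‖∑ j ∈ Finset.range k, g j‖ ≤ B) :
    ‖∑ i ∈ Finset.range n, f (i + 1) * g i‖ ≤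
      B * (‖f n‖ + ∑ i ∈ Finset.range (n - 1), ‖f (i + 2) - f (i + 1)‖) := by
  have hB0 : 0 ≤ B := (norm_nonneg _).trans (hB 0 (Nat.zero_le _))
  have habel := Finset.sum_range_by_parts (fun i => f (i + 1)) g n
  simp only [smul_eq_mul] at habel
  rw [habel]
  rcases Nat.eq_zero_or_pos n with rfl | hn
  · simp; positivity
  have hn1 : n - 1 + 1 = n := Nat.sub_add_cancel hn
  calc ‖f (n - 1 + 1) * ∑ j ∈ Finset.range n, g j -
        ∑ i ∈ Finset.range (n - 1), (f (i + 1 + 1) - f (i + 1)) * ∑ j ∈ Finset.range (i + 1), g j‖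
      ≤ ‖f (n - 1 + 1) * ∑ j ∈ Finset.range n, g j‖ +
        ‖∑ i ∈ Finset.range (n - 1), (f (i + 1 + 1) - f (i + 1)) * ∑ j ∈ Finset.range (i + 1), g j‖ :=
        norm_sub_le _ _
    _ ≤ ‖f n‖ * B + ∑ i ∈ Finset.range (n - 1), ‖f (i + 2) - f (i + 1)‖ * B := by
        rw [hn1]
        gcongr
        · rw [norm_mul]; exact mul_le_mul_of_nonneg_left (hB n le_rfl) (norm_nonneg _)
        · refine (norm_sum_le _ _).trans (Finset.sum_le_sum fun i hi => ?_)
          rw [norm_mul]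
          exact mul_le_mul_of_nonneg_left (hB (i + 1) (by
            have := Finset.mem_range.mp hi; omega)) (norm_nonneg _)
    _ = B * (‖f n‖ + ∑ i ∈ Finset.range (n - 1), ‖f (i + 2) - f (i + 1)‖) := by
        rw [← Finset.sum_mul]; ring

/-- For a smooth compactly supported `V`, `‖V x‖ ≤ ‖V‖_∞ = ⨆ ‖V‖` (the `iSup` in `bvNorm` is a
genuine bound). [cite: BondarenkoHeap2026, §4 p. 10] -/
theorem norm_le_iSup_norm {V : ℝ → ℂ} (hV : Continuous V) (hsupp : HasCompactSupport V) (x : ℝ) :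
    ‖V x‖ ≤ ⨆ y, ‖V y‖ :=
  le_ciSup ((hV.norm).bddAbove_range_of_hasCompactSupport hsupp.norm) x

/-- For a smooth compactly supported `V`, the total variation over the integers is at most
`∫ ‖V′‖`: `∑_{i<n} ‖V(i+2) − V(i+1)‖ ≤ ∫_ℝ ‖V′‖`. [cite: BondarenkoHeap2026, §4 p. 10] -/
theorem sum_norm_sub_le_integral {V : ℝ → ℂ} (hV : ContDiff ℝ ∞ V) (hsupp : HasCompactSupport V)
    (n : ℕ) : ∑ i ∈ Finset.range n, ‖V ((i : ℝ) + 2) - V ((i : ℝ) + 1)‖ ≤ ∫ y : ℝ, ‖deriv V y‖ := by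
  have hdiff : Differentiable ℝ V := hV.differentiable (by simp)
  have hcont' : Continuous (deriv V) := hV.continuous_deriv (by simp)
  have hint : Integrable (fun y => ‖deriv V y‖) :=
    (hcont'.integrable_of_hasCompactSupport hsupp.deriv).norm
  have hii : ∀ a b : ℝ, IntervalIntegrable (fun y => ‖deriv V y‖) volume a b :=
    fun a b => hcont'.norm.intervalIntegrable a b
  -- each difference is the integral of the derivative
  have hstep : ∀ i : ℕ, ‖V ((i : ℝ) + 2) - V ((i : ℝ) + 1)‖ ≤
      ∫ y in ((i : ℝ) + 1)..((i : ℝ) + 2), ‖deriv V y‖ := by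
    intro i
    have hle : (i : ℝ) + 1 ≤ (i : ℝ) + 2 := by linarith
    rw [← intervalIntegral.integral_deriv_eq_sub (fun x _ => hdiff x)
      (hcont'.intervalIntegrable _ _)]
    exact intervalIntegral.norm_integral_le_integral_norm hle
  refine (Finset.sum_le_sum fun i _ => hstep i).trans ?_
  have hadj : ∑ i ∈ Finset.range n, ∫ y in ((i : ℝ) + 1)..((i : ℝ) + 2), ‖deriv V y‖ =
      ∫ y in (1 : ℝ)..((n : ℝ) + 1), ‖deriv V y‖ := by
    have := intervalIntegral.sum_integral_adjacent_intervals (a := fun i : ℕ => (i : ℝ) + 1)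
      (n := n) (fun k _ => hii _ _)
    simp only [Nat.cast_zero, zero_add] at this
    rw [← this]
    refine Finset.sum_congr rfl fun i _ => ?_
    congr 1; push_cast; ring
  rw [hadj, intervalIntegral.integral_of_le (by linarith [(Nat.cast_nonneg n : (0 : ℝ) ≤ n)] :
    (1 : ℝ) ≤ (n : ℝ) + 1)]
  exact setIntegral_le_integral hint (Filter.Eventually.of_forall fun _ => norm_nonneg _)

/-- **`∑_{1 ≤ b ≤ q−1} 1/‖e(b/q) − 1‖ ≤ (q/2)(1 + log q)`** (the step
"`∑_{b ≤ q−1} (q‖b/q‖)^{−1} ≪ log q`"). [cite: BondarenkoHeap2026, §4 (proof of Lemma 4)] -/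
theorem sum_inv_norm_stdAddChar_sub_one_le (q : ℕ) [NeZero q] :
    ∑ b ∈ Finset.Ioo 0 q, 1 / ‖ZMod.stdAddChar ((b : ℤ) : ZMod q) - 1‖ ≤
      (q : ℝ) / 2 * (1 + Real.log q) := by
  have hq0 : (0 : ℝ) < q := by exact_mod_cast Nat.pos_of_ne_zero (NeZero.ne q)
  -- pointwise: 1/‖e(b/q)-1‖ ≤ (q/4)(1/b + 1/(q-b))
  have hpt : ∀ b ∈ Finset.Ioo 0 q, 1 / ‖ZMod.stdAddChar ((b : ℤ) : ZMod q) - 1‖ ≤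
      (q : ℝ) / 4 * (1 / b + 1 / ((q : ℝ) - b)) := by
    intro b hb
    obtain ⟨hb0, hbq⟩ := Finset.mem_Ioo.mp hb
    have hlow := four_mul_min_div_le_norm_stdAddChar_sub_one (q := q) hb0 hbq
    have hbpos : (0 : ℝ) < b := by exact_mod_cast hb0
    have hqb : (0 : ℝ) < q - b := by
      have : (b : ℝ) < q := by exact_mod_cast hbq
      linarith
    have hminpos : 0 < min (b : ℝ) (q - b) := lt_min hbpos hqb
    have hpos : 0 < 4 * min (b : ℝ) (q - b) / q := by positivity
    calc 1 / ‖ZMod.stdAddChar ((b : ℤ) : ZMod q) - 1‖ ≤ 1 / (4 * min (b : ℝ) (q - b) / q) :=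
          one_div_le_one_div_of_le hpos hlow
      _ = (q : ℝ) / 4 * (1 / min (b : ℝ) (q - b)) := by field_simp
      _ ≤ (q : ℝ) / 4 * (1 / b + 1 / ((q : ℝ) - b)) := by
          gcongr
          rcases le_total (b : ℝ) (q - b) with h | h
          · rw [min_eq_left h]; have : 0 ≤ 1 / ((q : ℝ) - b) := by positivity
            linarith
          · rw [min_eq_right h]; have : 0 ≤ 1 / (b : ℝ) := by positivity
            linarith
  refine (Finset.sum_le_sum hpt).trans ?_
  rw [← Finset.mul_sum, Finset.sum_add_distrib]
  -- reflect the second sum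
  have hrefl : ∑ b ∈ Finset.Ioo 0 q, 1 / ((q : ℝ) - b) = ∑ b ∈ Finset.Ioo 0 q, (1 : ℝ) / b := by
    refine Finset.sum_nbij' (fun b => q - b) (fun b => q - b) ?_ ?_ ?_ ?_ ?_
    · intro b hb; obtain ⟨h1, h2⟩ := Finset.mem_Ioo.mp hb; rw [Finset.mem_Ioo]; omega
    · intro b hb; obtain ⟨h1, h2⟩ := Finset.mem_Ioo.mp hb; rw [Finset.mem_Ioo]; omega
    · intro b hb; obtain ⟨h1, h2⟩ := Finset.mem_Ioo.mp hb; omega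
    · intro b hb; obtain ⟨h1, h2⟩ := Finset.mem_Ioo.mp hb; omega
    · intro b hb
      obtain ⟨h1, h2⟩ := Finset.mem_Ioo.mp hb
      rw [Nat.cast_sub h2.le]
  rw [hrefl, ← two_mul]
  -- harmonic bound
  have hharm : ∑ b ∈ Finset.Ioo 0 q, (1 : ℝ) / b ≤ 1 + Real.log q := by
    have hsub : Finset.Ioo 0 q ⊆ Finset.Icc 1 q := by
      intro b hb; obtain ⟨h1, h2⟩ := Finset.mem_Ioo.mp hb; rw [Finset.mem_Icc]; omega
    calc ∑ b ∈ Finset.Ioo 0 q, (1 : ℝ) / b ≤ ∑ b ∈ Finset.Icc 1 q, (1 : ℝ) / b :=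
          Finset.sum_le_sum_of_subset_of_nonneg hsub fun _ _ _ => by positivity
      _ = harmonic q := by
          rw [harmonic_eq_sum_Icc]; push_cast
          refine Finset.sum_congr rfl fun b _ => ?_
          rw [one_div]
      _ ≤ 1 + Real.log q := harmonic_le_one_add_log q
  calc (q : ℝ) / 4 * (2 * ∑ b ∈ Finset.Ioo 0 q, (1 : ℝ) / b)
      = (q : ℝ) / 2 * ∑ b ∈ Finset.Ioo 0 q, (1 : ℝ) / b := by ring
    _ ≤ (q : ℝ) / 2 * (1 + Real.log q) := by gcongr

/-- The sum over the nonzero residues of `1/‖e(b/q) − 1‖`, indexed by `ZMod q`.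
[cite: BondarenkoHeap2026, §4 (proof of Lemma 4)] -/
theorem sum_erase_zero_inv_norm_stdAddChar_sub_one_le (q : ℕ) [NeZero q] :
    ∑ b ∈ (Finset.univ : Finset (ZMod q)).erase 0, 1 / ‖ZMod.stdAddChar b - 1‖ ≤
      (q : ℝ) / 2 * (1 + Real.log q) := by
  classical
  have hre : ∑ b ∈ (Finset.univ : Finset (ZMod q)).erase 0, 1 / ‖ZMod.stdAddChar b - 1‖ =
      ∑ n ∈ Finset.Ioo 0 q, 1 / ‖ZMod.stdAddChar ((n : ℤ) : ZMod q) - 1‖ := by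
    refine Finset.sum_nbij' (fun b : ZMod q => b.val) (fun n : ℕ => (n : ZMod q)) ?_ ?_ ?_ ?_ ?_
    · intro b hb
      have hb0 : b ≠ 0 := (Finset.mem_erase.mp hb).1
      rw [Finset.mem_Ioo]
      exact ⟨Nat.pos_of_ne_zero ((ZMod.val_ne_zero b).mpr hb0), ZMod.val_lt b⟩
    · intro n hn
      obtain ⟨h0, hq⟩ := Finset.mem_Ioo.mp hn
      rw [Finset.mem_erase]
      refine ⟨?_, Finset.mem_univ _⟩
      intro h
      have : (n : ZMod q).val = n := ZMod.val_natCast_of_lt hq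
      rw [h, ZMod.val_zero] at this
      omega
    · intro b _; exact ZMod.natCast_zmod_val b
    · intro n hn
      obtain ⟨_, hq⟩ := Finset.mem_Ioo.mp hn
      exact ZMod.val_natCast_of_lt hq
    · intro b _
      rw [Int.cast_natCast, ZMod.natCast_zmod_val]
  rw [hre]
  exact sum_inv_norm_stdAddChar_sub_one_le q

/-- `(r, b, Q) ≤ (r, Q)` for the gcds of (14) (`Q ≠ 0`). [folklore] -/
private theorem gcd_gcd_le_gcd (r : ℤ) (b : ℕ) {Q : ℕ} (hQ : Q ≠ 0) :
    Int.gcd (Int.gcd r b : ℤ) Q ≤ Int.gcd r Q := by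
  have h1 : ((Int.gcd (Int.gcd r b : ℤ) Q : ℕ) : ℤ) ∣ r :=
    (Int.gcd_dvd_left _ _).trans (Int.gcd_dvd_left _ _)
  have h2 : ((Int.gcd (Int.gcd r b : ℤ) Q : ℕ) : ℤ) ∣ (Q : ℤ) := Int.gcd_dvd_right _ _
  have h3 : ((Int.gcd (Int.gcd r b : ℤ) Q : ℕ) : ℤ) ∣ (Int.gcd r Q : ℤ) := Int.dvd_coe_gcd h1 h2
  have h4 : Int.gcd (Int.gcd r b : ℤ) Q ∣ Int.gcd r Q := by exact_mod_cast h3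
  have hpos : 0 < Int.gcd r Q := Int.gcd_pos_of_ne_zero_right _ (by exact_mod_cast hQ)
  exact Nat.le_of_dvd hpos h4

/-- **Lemma 4 follows from (14)** (by the completion identity (13), the geometric-sum bound for
`∑_n V(n)e(bn/q)` after partial summation against the bounded-variation weight, and
`∑_{b} (q‖b/q‖)^{-1} ≪ log q`), with `δ = ε/3` and `C = C₁₄(ε/3)·A²·(2 + 3/ε)`.
[cite: BondarenkoHeap2026, Lemma 4 (proof)] -/
theorem lemma4_of_eq14 (h14 : eq14) : lemma4 := by
  intro ε hε A hA
  obtain ⟨C₁, hC₁, h14'⟩ := h14 (ε / 3) (by positivity)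
  refine ⟨ε / 3, by positivity, C₁ * A ^ 2 * (2 + 3 / ε), by positivity, ?_⟩
  intro q _ χ hprim hquad ν Q hq hQodd k r hk hr M hM V hV hsuppV hBV
  classical
  obtain ⟨h0, hb⟩ := h14' q χ hprim hquad ν Q hq hQodd k r hk hr
  have hQ0 : Q ≠ 0 := by rintro rfl; exact (Nat.not_odd_zero hQodd).elim
  have hq0 : (0 : ℝ) < q := by exact_mod_cast Nat.pos_of_ne_zero (NeZero.ne q)
  have hq1 : (1 : ℝ) ≤ q := by exact_mod_cast Nat.pos_of_ne_zero (NeZero.ne q)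
  have hA0 : 0 < A := by linarith
  -- the weight: compact support, sup and variation
  have hcs : HasCompactSupport V := by
    refine HasCompactSupport.intro (isCompact_Icc : IsCompact (Set.Icc (M / A) (A * M)))
      fun x hx => ?_
    by_contra h
    exact hx (hsuppV (Function.mem_support.mpr h))
  have hVc : Continuous V := hV.continuous
  set N : ℕ := ⌊A * M⌋₊ with hN
  set g : ℕ := Int.gcd r Q with hg
  set BV : ℝ := bvNorm V with hBVdef
  have hBV0 : 0 ≤ BV := by
    have h1 : 0 ≤ ⨆ y, ‖V y‖ := Real.iSup_nonneg fun _ => norm_nonneg _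
    have h2 : 0 ≤ ∫ y : ℝ, ‖deriv V y‖ := integral_nonneg fun _ => norm_nonneg _
    simp only [hBVdef, bvNorm]; linarith
  have hsup : ∀ x, ‖V x‖ ≤ ⨆ y, ‖V y‖ := norm_le_iSup_norm hVc hcs
  have hsupBV : ∀ x, ‖V x‖ ≤ BV := fun x => (hsup x).trans (by
    have h2 : 0 ≤ ∫ y : ℝ, ‖deriv V y‖ := integral_nonneg fun _ => norm_nonneg _
    simp only [hBVdef, bvNorm]; linarith)
  have hNle : (N : ℝ) ≤ A * M := Nat.floor_le (by positivity)
  -- (13)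
  rw [show (∑ m ∈ Finset.Icc 1 N, V (m : ℝ) * χ (m : ZMod q) * χ ((k * m + r : ℤ) : ZMod q)) = _
    from completion_identity_split χ k r (Finset.Icc 1 N) (fun n => V (n : ℝ))]
  -- Term 1
  have hT1 : ‖twistedShiftSum χ k r 0 / q * ∑ n ∈ Finset.Icc 1 N, V (n : ℝ)‖ ≤
      C₁ * A ^ 2 * (q : ℝ) ^ ε * (M * g / q) := by
    have hsumV : ‖∑ n ∈ Finset.Icc 1 N, V (n : ℝ)‖ ≤ N * BV := by
      calc ‖∑ n ∈ Finset.Icc 1 N, V (n : ℝ)‖ ≤ ∑ n ∈ Finset.Icc 1 N, ‖V (n : ℝ)‖ := norm_sum_le _ _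
        _ ≤ ∑ n ∈ Finset.Icc 1 N, BV := Finset.sum_le_sum fun n _ => hsupBV n
        _ = N * BV := by rw [Finset.sum_const, Nat.card_Icc, nsmul_eq_mul]; push_cast; ring
    rw [norm_mul, norm_div, Complex.norm_natCast]
    calc ‖twistedShiftSum χ k r 0‖ / q * ‖∑ n ∈ Finset.Icc 1 N, V (n : ℝ)‖
        ≤ (C₁ * (q : ℝ) ^ (ε / 3) * g) / q * (N * BV) := by gcongr
      _ ≤ (C₁ * (q : ℝ) ^ (ε / 3) * g) / q * ((A * M) * (A * (q : ℝ) ^ (ε / 3))) := by gcongr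
      _ = C₁ * A ^ 2 * ((q : ℝ) ^ (ε / 3) * (q : ℝ) ^ (ε / 3)) * (M * g / q) := by ring
      _ ≤ C₁ * A ^ 2 * (q : ℝ) ^ ε * (M * g / q) := by
          gcongr
          rw [← Real.rpow_add hq0]
          exact Real.rpow_le_rpow_of_exponent_le hq1 (by linarith)
  -- Term 2: each `W_b`
  have hW : ∀ b : ZMod q, b ≠ 0 →
      ‖∑ n ∈ Finset.Icc 1 N, V (n : ℝ) * ZMod.stdAddChar (b * (n : ZMod q))‖ ≤
        2 / ‖ZMod.stdAddChar b - 1‖ * BV := by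
    intro b hb0
    have hre : ∑ n ∈ Finset.Icc 1 N, V (n : ℝ) * ZMod.stdAddChar (b * (n : ZMod q)) =
        ∑ i ∈ Finset.range N, (fun i : ℕ => V (i : ℝ)) (i + 1) *
          ZMod.stdAddChar (b * ((i + 1 : ℕ) : ZMod q)) := by
      rw [← Finset.Ico_add_one_right_eq_Icc, Finset.sum_Ico_eq_sum_range]
      simp only [Nat.add_sub_cancel]
      refine Finset.sum_congr rfl fun i _ => ?_
      rw [add_comm 1 i]
    rw [hre]
    have hB : ∀ m ≤ N, ‖∑ j ∈ Finset.range m, ZMod.stdAddChar (b * ((j + 1 : ℕ) : ZMod q))‖ ≤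
        2 / ‖ZMod.stdAddChar b - 1‖ := fun m _ => norm_sum_stdAddChar_le hb0 m
    refine (norm_sum_mul_le_of_partial_sums (fun i : ℕ => V (i : ℝ)) _ N hB).trans ?_
    have hBb : 0 ≤ 2 / ‖ZMod.stdAddChar b - 1‖ := by positivity
    refine mul_le_mul_of_nonneg_left ?_ hBb
    have hvar := sum_norm_sub_le_integral hV hcs (N - 1)
    have hvar' : ∑ i ∈ Finset.range (N - 1), ‖V ((i + 2 : ℕ) : ℝ) - V ((i + 1 : ℕ) : ℝ)‖ ≤
        ∫ y : ℝ, ‖deriv V y‖ := by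
      refine le_trans (le_of_eq (Finset.sum_congr rfl fun i _ => ?_)) hvar
      push_cast; ring_nf
    calc ‖V ((N : ℕ) : ℝ)‖ + ∑ i ∈ Finset.range (N - 1), ‖V ((i + 2 : ℕ) : ℝ) - V ((i + 1 : ℕ) : ℝ)‖
        ≤ (⨆ y, ‖V y‖) + ∫ y : ℝ, ‖deriv V y‖ := add_le_add (hsup _) hvar'
      _ = BV := rfl
  -- Term 2 total
  have hT2 : ‖(1 / (q : ℂ)) * ∑ b ∈ (Finset.univ : Finset (ZMod q)).erase 0,
      twistedShiftSum χ k r b * ∑ n ∈ Finset.Icc 1 N, V (n : ℝ) * ZMod.stdAddChar (b * (n : ZMod q))‖ ≤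
      C₁ * A * (1 + 3 / ε) * (q : ℝ) ^ ε * Real.sqrt (q * g) := by
    have hsqg : ∀ b : ZMod q, Real.sqrt (Int.gcd (Int.gcd r b.val : ℤ) Q) ≤ Real.sqrt g :=
      fun b => Real.sqrt_le_sqrt (by exact_mod_cast gcd_gcd_le_gcd r b.val hQ0)
    have hterm : ∀ b ∈ (Finset.univ : Finset (ZMod q)).erase 0,
        ‖twistedShiftSum χ k r b * ∑ n ∈ Finset.Icc 1 N, V (n : ℝ) * ZMod.stdAddChar (b * (n : ZMod q))‖ ≤
          (C₁ * (q : ℝ) ^ (1 / 2 + ε / 3) * Real.sqrt g * (2 * BV)) * (1 / ‖ZMod.stdAddChar b - 1‖) := by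
      intro b hbmem
      have hb0 : b ≠ 0 := (Finset.mem_erase.mp hbmem).1
      rw [norm_mul]
      have hBb : 0 ≤ 2 / ‖ZMod.stdAddChar b - 1‖ * BV := by positivity
      calc ‖twistedShiftSum χ k r b‖ * ‖∑ n ∈ Finset.Icc 1 N, V (n : ℝ) * ZMod.stdAddChar (b * (n : ZMod q))‖
          ≤ (C₁ * (q : ℝ) ^ (1 / 2 + ε / 3) * Real.sqrt (Int.gcd (Int.gcd r b.val : ℤ) Q)) *
              (2 / ‖ZMod.stdAddChar b - 1‖ * BV) :=
            mul_le_mul (hb b hb0) (hW b hb0) (norm_nonneg _) (by positivity)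
        _ ≤ (C₁ * (q : ℝ) ^ (1 / 2 + ε / 3) * Real.sqrt g) * (2 / ‖ZMod.stdAddChar b - 1‖ * BV) :=
            mul_le_mul_of_nonneg_right (mul_le_mul_of_nonneg_left (hsqg b) (by positivity)) hBb
        _ = (C₁ * (q : ℝ) ^ (1 / 2 + ε / 3) * Real.sqrt g * (2 * BV)) * (1 / ‖ZMod.stdAddChar b - 1‖) := by
            ring
    have hlog : 1 + Real.log q ≤ (1 + 3 / ε) * (q : ℝ) ^ (ε / 3) := by
      have h1 : Real.log q ≤ (q : ℝ) ^ (ε / 3) / (ε / 3) := Real.log_le_rpow_div hq0.le (by positivity)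
      have h2 : (1 : ℝ) ≤ (q : ℝ) ^ (ε / 3) := Real.one_le_rpow hq1 (by positivity)
      calc 1 + Real.log q ≤ (q : ℝ) ^ (ε / 3) + (q : ℝ) ^ (ε / 3) / (ε / 3) := add_le_add h2 h1
        _ = (1 + 3 / ε) * (q : ℝ) ^ (ε / 3) := by field_simp
    rw [norm_mul, norm_div, norm_one, Complex.norm_natCast]
    calc 1 / (q : ℝ) * ‖∑ b ∈ (Finset.univ : Finset (ZMod q)).erase 0,
          twistedShiftSum χ k r b * ∑ n ∈ Finset.Icc 1 N, V (n : ℝ) * ZMod.stdAddChar (b * (n : ZMod q))‖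
        ≤ 1 / (q : ℝ) * ∑ b ∈ (Finset.univ : Finset (ZMod q)).erase 0,
          ‖twistedShiftSum χ k r b * ∑ n ∈ Finset.Icc 1 N, V (n : ℝ) * ZMod.stdAddChar (b * (n : ZMod q))‖ := by
          gcongr; exact norm_sum_le _ _
      _ ≤ 1 / (q : ℝ) * ∑ b ∈ (Finset.univ : Finset (ZMod q)).erase 0,
          (C₁ * (q : ℝ) ^ (1 / 2 + ε / 3) * Real.sqrt g * (2 * BV)) * (1 / ‖ZMod.stdAddChar b - 1‖) := by
          gcongr with b hb'
          exact hterm b hb'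
      _ = 1 / (q : ℝ) * ((C₁ * (q : ℝ) ^ (1 / 2 + ε / 3) * Real.sqrt g * (2 * BV)) *
          ∑ b ∈ (Finset.univ : Finset (ZMod q)).erase 0, 1 / ‖ZMod.stdAddChar b - 1‖) := by
          rw [← Finset.mul_sum]
      _ ≤ 1 / (q : ℝ) * ((C₁ * (q : ℝ) ^ (1 / 2 + ε / 3) * Real.sqrt g * (2 * BV)) *
          ((q : ℝ) / 2 * (1 + Real.log q))) := by
          gcongr; exact sum_erase_zero_inv_norm_stdAddChar_sub_one_le q
      _ = C₁ * (q : ℝ) ^ (1 / 2 + ε / 3) * Real.sqrt g * BV * (1 + Real.log q) := by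
          field_simp
      _ ≤ C₁ * (q : ℝ) ^ (1 / 2 + ε / 3) * Real.sqrt g * (A * (q : ℝ) ^ (ε / 3)) *
          ((1 + 3 / ε) * (q : ℝ) ^ (ε / 3)) := by gcongr
      _ = C₁ * A * (1 + 3 / ε) * ((q : ℝ) ^ (1 / 2 + ε / 3) * (q : ℝ) ^ (ε / 3) * (q : ℝ) ^ (ε / 3)) *
          Real.sqrt g := by ring
      _ = C₁ * A * (1 + 3 / ε) * ((q : ℝ) ^ ε * Real.sqrt q) * Real.sqrt g := by
          congr 2
          rw [← Real.rpow_add hq0, ← Real.rpow_add hq0, Real.sqrt_eq_rpow, ← Real.rpow_add hq0]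
          ring_nf
      _ = C₁ * A * (1 + 3 / ε) * (q : ℝ) ^ ε * Real.sqrt (q * g) := by
          rw [Real.sqrt_mul hq0.le]; ring
  -- assemble
  calc ‖twistedShiftSum χ k r 0 / q * ∑ n ∈ Finset.Icc 1 N, V (n : ℝ) +
        (1 / (q : ℂ)) * ∑ b ∈ (Finset.univ : Finset (ZMod q)).erase 0,
          twistedShiftSum χ k r b * ∑ n ∈ Finset.Icc 1 N, V (n : ℝ) * ZMod.stdAddChar (b * (n : ZMod q))‖
      ≤ C₁ * A ^ 2 * (q : ℝ) ^ ε * (M * g / q) + C₁ * A * (1 + 3 / ε) * (q : ℝ) ^ ε * Real.sqrt (q * g) :=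
        (norm_add_le _ _).trans (add_le_add hT1 hT2)
    _ ≤ C₁ * A ^ 2 * (2 + 3 / ε) * (q : ℝ) ^ ε * (M * g / q) +
        C₁ * A ^ 2 * (2 + 3 / ε) * (q : ℝ) ^ ε * Real.sqrt (q * g) := by
        have hMg : 0 ≤ M * (g : ℝ) / q := by positivity
        have hsq : 0 ≤ Real.sqrt (q * g) := Real.sqrt_nonneg _
        have hqe : 0 ≤ (q : ℝ) ^ ε := by positivity
        have hA1 : A ≤ A ^ 2 := by nlinarith
        have h3e : (0 : ℝ) < 3 / ε := by positivity
        have hle1 : C₁ * A ^ 2 * (q : ℝ) ^ ε * (M * g / q) ≤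
            C₁ * A ^ 2 * (2 + 3 / ε) * (q : ℝ) ^ ε * (M * g / q) := by
          have hP : 0 ≤ C₁ * A ^ 2 * (q : ℝ) ^ ε * (M * g / q) := by positivity
          calc C₁ * A ^ 2 * (q : ℝ) ^ ε * (M * g / q)
              = (C₁ * A ^ 2 * (q : ℝ) ^ ε * (M * g / q)) * 1 := by ring
            _ ≤ (C₁ * A ^ 2 * (q : ℝ) ^ ε * (M * g / q)) * (2 + 3 / ε) :=
                mul_le_mul_of_nonneg_left (by linarith) hP
            _ = C₁ * A ^ 2 * (2 + 3 / ε) * (q : ℝ) ^ ε * (M * g / q) := by ring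
        have hle2 : C₁ * A * (1 + 3 / ε) * (q : ℝ) ^ ε * Real.sqrt (q * g) ≤
            C₁ * A ^ 2 * (2 + 3 / ε) * (q : ℝ) ^ ε * Real.sqrt (q * g) := by
          have hP : 0 ≤ C₁ * (q : ℝ) ^ ε * Real.sqrt (q * g) := by positivity
          have hcoef : A * (1 + 3 / ε) ≤ A ^ 2 * (2 + 3 / ε) :=
            mul_le_mul hA1 (by linarith) (by positivity) (by positivity)
          calc C₁ * A * (1 + 3 / ε) * (q : ℝ) ^ ε * Real.sqrt (q * g)
              = (C₁ * (q : ℝ) ^ ε * Real.sqrt (q * g)) * (A * (1 + 3 / ε)) := by ring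
            _ ≤ (C₁ * (q : ℝ) ^ ε * Real.sqrt (q * g)) * (A ^ 2 * (2 + 3 / ε)) :=
                mul_le_mul_of_nonneg_left hcoef hP
            _ = C₁ * A ^ 2 * (2 + 3 / ε) * (q : ℝ) ^ ε * Real.sqrt (q * g) := by ring
        exact add_le_add hle1 hle2
    _ = C₁ * A ^ 2 * (2 + 3 / ε) * (q : ℝ) ^ ε * (M * g / q + Real.sqrt (q * g)) := by ring

end Lemma4Proof

section Eq18Proof

open MeasureTheory intervalIntegral Set

/-! ### §5 (18): the correlation profile `C_G` is continuous, bounded and Lipschitz on `[0,1]` -/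

/-- `C_G` is continuous (parametric interval integral of a jointly continuous integrand with a
continuous upper limit). [cite: BondarenkoHeap2026, Theorem 4 p. 8 (C_G)] -/
theorem continuous_cG (G₀ : Polynomial ℝ) : Continuous (cG G₀) := by
  unfold cG
  have hf : Continuous (Function.uncurry fun (u x : ℝ) => G₀.eval x * G₀.eval (x + u)) := by
    exact (G₀.continuous.comp continuous_snd).mul (G₀.continuous.comp (continuous_snd.add continuous_fst))
  exact intervalIntegral.continuous_parametric_intervalIntegral_of_continuous (a₀ := 0) hf
    (continuous_const.sub continuous_id)

/-- A bound `M ≥ 0` for `|G₀|` and `|G₀'|` on `[0, 2]`. [folklore] -/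
private theorem exists_bound_poly (G₀ : Polynomial ℝ) :
    ∃ M : ℝ, 0 ≤ M ∧ (∀ x ∈ Set.Icc (0 : ℝ) 2, |G₀.eval x| ≤ M) ∧
      ∀ x ∈ Set.Icc (0 : ℝ) 2, |(Polynomial.derivative G₀).eval x| ≤ M := by
  obtain ⟨M₁, hM₁⟩ := isCompact_Icc.exists_bound_of_continuousOn (G₀.continuous.continuousOn (s := Set.Icc (0:ℝ) 2))
  obtain ⟨M₂, hM₂⟩ := isCompact_Icc.exists_bound_of_continuousOn
    ((Polynomial.derivative G₀).continuous.continuousOn (s := Set.Icc (0:ℝ) 2))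
  refine ⟨max (max M₁ M₂) 0, le_max_right _ _, fun x hx => ?_, fun x hx => ?_⟩
  · exact (hM₁ x hx).trans ((le_max_left _ _).trans (le_max_left _ _))
  · exact (hM₂ x hx).trans ((le_max_right _ _).trans (le_max_left _ _))

/-- `C_G` is bounded and Lipschitz on `[0, 1]`: `|C_G(u)| ≤ M²` and
`|C_G(u) − C_G(v)| ≤ 2M²|u − v|` with `M` a bound for `|G₀|, |G₀'|` on `[0,2]`.
[cite: BondarenkoHeap2026, Theorem 4 p. 8 (C_G)] -/
theorem cG_bound_lipschitz (G₀ : Polynomial ℝ) :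
    ∃ M : ℝ, 0 ≤ M ∧ (∀ u ∈ Set.Icc (0 : ℝ) 1, |cG G₀ u| ≤ M) ∧
      ∀ u ∈ Set.Icc (0 : ℝ) 1, ∀ v ∈ Set.Icc (0 : ℝ) 1, |cG G₀ u - cG G₀ v| ≤ M * |u - v| := by
  obtain ⟨M, hM0, hG, hG'⟩ := exists_bound_poly G₀
  refine ⟨2 * M ^ 2 + M, by positivity, fun u hu => ?_, fun u hu v hv => ?_⟩
  · -- bound
    rw [cG]
    have hle : (0 : ℝ) ≤ 1 - u := by linarith [hu.2]
    have h1 : ‖∫ x in (0 : ℝ)..(1 - u), G₀.eval x * G₀.eval (x + u)‖ ≤ M ^ 2 * |1 - u - 0| := by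
      refine intervalIntegral.norm_integral_le_of_norm_le_const fun x hx => ?_
      rw [Set.uIoc_of_le hle] at hx
      have hx' : x ∈ Set.Icc (0 : ℝ) 2 := ⟨hx.1.le, by linarith [hx.2, hu.1]⟩
      have hxu : x + u ∈ Set.Icc (0 : ℝ) 2 := ⟨by linarith [hx.1, hu.1], by linarith [hx.2, hu.2]⟩
      rw [Real.norm_eq_abs, abs_mul, sq]
      exact mul_le_mul (hG x hx') (hG _ hxu) (abs_nonneg _) hM0
    rw [Real.norm_eq_abs] at h1
    calc |∫ x in (0 : ℝ)..(1 - u), G₀.eval x * G₀.eval (x + u)| ≤ M ^ 2 * |1 - u - 0| := h1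
      _ ≤ M ^ 2 * 1 := by gcongr; rw [sub_zero, abs_of_nonneg hle]; linarith [hu.1]
      _ ≤ 2 * M ^ 2 + M := by nlinarith
  · -- Lipschitz
    have hle_u : (0 : ℝ) ≤ 1 - u := by linarith [hu.2]
    have hle_v : (0 : ℝ) ≤ 1 - v := by linarith [hv.2]
    -- Lipschitz bound for G₀ on [0,2] (mean value theorem)
    have hLipG : ∀ a ∈ Set.Icc (0 : ℝ) 2, ∀ b ∈ Set.Icc (0 : ℝ) 2,
        |G₀.eval a - G₀.eval b| ≤ M * |a - b| := by
      intro a ha b hb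
      have := Convex.norm_image_sub_le_of_norm_deriv_le (f := fun x => G₀.eval x) (s := Set.Icc (0:ℝ) 2)
        (fun x _ => G₀.differentiableAt) (fun x hx => by
          rw [Polynomial.deriv, Real.norm_eq_abs]; exact hG' x hx) (convex_Icc 0 2) hb ha
      simpa [Real.norm_eq_abs] using this
    rw [cG, cG]
    -- split: ∫₀^{1-u} h(u,·) − ∫₀^{1-v} h(v,·) = ∫₀^{1-u} (h(u,·) − h(v,·)) + (∫₀^{1-u} h(v,·) − ∫₀^{1-v} h(v,·))
    have hint : ∀ w z : ℝ, IntervalIntegrable (fun x => G₀.eval x * G₀.eval (x + w)) volume 0 z :=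
      fun w z => ((G₀.continuous).mul (G₀.continuous.comp (continuous_id.add continuous_const))).intervalIntegrable _ _
    have hsplit : (∫ x in (0 : ℝ)..(1 - u), G₀.eval x * G₀.eval (x + u)) -
        (∫ x in (0 : ℝ)..(1 - v), G₀.eval x * G₀.eval (x + v)) =
        (∫ x in (0 : ℝ)..(1 - u), (G₀.eval x * G₀.eval (x + u) - G₀.eval x * G₀.eval (x + v))) +
        ∫ x in (1 - v)..(1 - u), G₀.eval x * G₀.eval (x + v) := by
      rw [intervalIntegral.integral_sub (hint u _) (hint v _),
        ← intervalIntegral.integral_interval_sub_left (hint v (1 - u)) (hint v (1 - v))]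
      ring
    rw [hsplit]
    have hA : |∫ x in (0 : ℝ)..(1 - u), (G₀.eval x * G₀.eval (x + u) - G₀.eval x * G₀.eval (x + v))|
        ≤ M * (M * |u - v|) * |1 - u - 0| := by
      have := intervalIntegral.norm_integral_le_of_norm_le_const (a := 0) (b := 1 - u)
        (f := fun x => G₀.eval x * G₀.eval (x + u) - G₀.eval x * G₀.eval (x + v))
        (C := M * (M * |u - v|)) (fun x hx => by
          rw [Set.uIoc_of_le hle_u] at hx
          have hx' : x ∈ Set.Icc (0 : ℝ) 2 := ⟨hx.1.le, by linarith [hx.2, hu.1]⟩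
          have hxu : x + u ∈ Set.Icc (0 : ℝ) 2 := ⟨by linarith [hx.1, hu.1], by linarith [hx.2, hu.2]⟩
          have hxv : x + v ∈ Set.Icc (0 : ℝ) 2 := ⟨by linarith [hx.1, hv.1], by linarith [hx.2, hu.1, hv.2]⟩
          rw [← mul_sub, norm_mul, Real.norm_eq_abs, Real.norm_eq_abs]
          refine mul_le_mul (hG x hx') ?_ (abs_nonneg _) hM0
          have := hLipG (x + u) hxu (x + v) hxv
          rwa [show x + u - (x + v) = u - v by ring] at this)
      rwa [Real.norm_eq_abs] at this
    have hB : |∫ x in (1 - v)..(1 - u), G₀.eval x * G₀.eval (x + v)| ≤ M ^ 2 * |1 - u - (1 - v)| := by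
      have := intervalIntegral.norm_integral_le_of_norm_le_const (a := 1 - v) (b := 1 - u)
        (f := fun x => G₀.eval x * G₀.eval (x + v)) (C := M ^ 2) (fun x hx => by
          have hx2 : x ∈ Set.Icc (0 : ℝ) 2 := by
            rcases Set.mem_uIoc.mp hx with h | h
            · exact ⟨by linarith [h.1, hv.2], by linarith [h.2, hu.1]⟩
            · exact ⟨by linarith [h.1, hu.2], by linarith [h.2, hv.1]⟩
          have hxv : x + v ∈ Set.Icc (0 : ℝ) 2 := by
            rcases Set.mem_uIoc.mp hx with h | h
            · exact ⟨by linarith [h.1, hv.1, hv.2], by linarith [h.2, hu.1, hv.2]⟩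
            · exact ⟨by linarith [h.1, hu.2, hv.1], by linarith [h.2, hv.1, hv.2]⟩
          rw [norm_mul, Real.norm_eq_abs, Real.norm_eq_abs, sq]
          exact mul_le_mul (hG x hx2) (hG _ hxv) (abs_nonneg _) hM0)
      rwa [Real.norm_eq_abs] at this
    have h1u : |1 - u - 0| ≤ 1 := by rw [sub_zero, abs_of_nonneg hle_u]; linarith [hu.1]
    have h2 : |1 - u - (1 - v)| = |u - v| := by
      rw [show 1 - u - (1 - v) = -(u - v) by ring, abs_neg]
    calc |(∫ x in (0 : ℝ)..(1 - u), (G₀.eval x * G₀.eval (x + u) - G₀.eval x * G₀.eval (x + v))) +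
          ∫ x in (1 - v)..(1 - u), G₀.eval x * G₀.eval (x + v)|
        ≤ M * (M * |u - v|) * |1 - u - 0| + M ^ 2 * |1 - u - (1 - v)| :=
          (abs_add_le _ _).trans (add_le_add hA hB)
      _ ≤ M * (M * |u - v|) * 1 + M ^ 2 * |u - v| := by rw [h2]; gcongr
      _ = 2 * M ^ 2 * |u - v| := by ring
      _ ≤ (2 * M ^ 2 + M) * |u - v| := by nlinarith [abs_nonneg (u - v)]


/-! ### §5 (18): the Lipschitz weight handed to Ford's long-range prime sum lemma -/

/-- `|sin a − sin b| ≤ |a − b|`. [folklore] -/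
private theorem abs_sin_sub_sin_le (a b : ℝ) : |Real.sin a - Real.sin b| ≤ |a - b| := by
  have := Real.lipschitzWith_sin.dist_le_mul a b
  simpa [Real.dist_eq] using this

/-- The clamp of `t` to `[ε, 2]`. [folklore] -/
private def clampI (ε t : ℝ) : ℝ := max ε (min t 2)

/-- The piecewise-linear cut-off: `0` for `t ≤ ε`, `1` for `t ≥ 2ε`. [folklore] -/
private def cutoff (ε t : ℝ) : ℝ := max 0 (min 1 ((t - ε) / ε))

/-- The profile `g(t) = C_G(t/2) sin(κt/2)/t` (`= Ψ(t/2)/t`, `Ψ(u) = C_G(u) sin(πcϑu)`, `κ = πcϑ`).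
[cite: BondarenkoHeap2026, §5 (18)] -/
private def gProfile (κ : ℝ) (G₀ : Polynomial ℝ) (t : ℝ) : ℝ :=
  cG G₀ (t / 2) * Real.sin (κ * t / 2) / t

/-- The weight `F(t) = cutoff_ε(t) · g(clamp_{[ε,2]} t)`: Lipschitz, bounded, supported in
`[ε, 2]`, and equal to `g` on `[2ε, 2]`. [cite: BondarenkoHeap2026, §5 (18)] -/
private def fordWeight (κ ε : ℝ) (G₀ : Polynomial ℝ) (t : ℝ) : ℝ :=
  cutoff ε t * gProfile κ G₀ (clampI ε t)

/-- The clamp lands in `[ε, 2]` (`ε ≤ 2`). [folklore] -/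
private theorem clampI_mem {ε : ℝ} (hε2 : ε ≤ 2) (t : ℝ) :
    clampI ε t ∈ Set.Icc ε 2 := by
  unfold clampI
  exact ⟨le_max_left _ _, max_le hε2 (min_le_right _ _)⟩

/-- The clamp is the identity on `[ε, 2]`. [folklore] -/
private theorem clampI_of_mem {ε t : ℝ} (ht : t ∈ Set.Icc ε 2) : clampI ε t = t := by
  unfold clampI
  rw [min_eq_left ht.2, max_eq_right ht.1]

/-- The clamp is `1`-Lipschitz. [folklore] -/
private theorem abs_clampI_sub_le (ε t t' : ℝ) : |clampI ε t - clampI ε t'| ≤ |t - t'| := by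
  unfold clampI
  calc |max ε (min t 2) - max ε (min t' 2)| ≤ max |ε - ε| |min t 2 - min t' 2| :=
        abs_max_sub_max_le_max _ _ _ _
    _ ≤ max |ε - ε| (max |t - t'| |(2:ℝ) - 2|) := by
        gcongr; exact abs_min_sub_min_le_max _ _ _ _
    _ = |t - t'| := by simp [abs_nonneg]

/-- The cut-off takes values in `[0, 1]`. [folklore] -/
private theorem cutoff_mem (ε t : ℝ) : cutoff ε t ∈ Set.Icc (0 : ℝ) 1 := by
  unfold cutoff
  exact ⟨le_max_left _ _, max_le zero_le_one (min_le_left _ _)⟩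

/-- The cut-off vanishes on `t ≤ ε`. [folklore] -/
private theorem cutoff_of_le {ε t : ℝ} (hε : 0 < ε) (ht : t ≤ ε) : cutoff ε t = 0 := by
  unfold cutoff
  have : (t - ε) / ε ≤ 0 := div_nonpos_of_nonpos_of_nonneg (by linarith) hε.le
  rw [max_eq_left]
  exact (min_le_right _ _).trans this

/-- The cut-off equals `1` on `t ≥ 2ε`. [folklore] -/
private theorem cutoff_of_ge {ε t : ℝ} (hε : 0 < ε) (ht : 2 * ε ≤ t) : cutoff ε t = 1 := by
  unfold cutoff
  have : 1 ≤ (t - ε) / ε := by rw [le_div_iff₀ hε]; linarith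
  rw [min_eq_left this, max_eq_right zero_le_one]

/-- The cut-off is `(1/ε)`-Lipschitz. [folklore] -/
private theorem abs_cutoff_sub_le {ε : ℝ} (hε : 0 < ε) (t t' : ℝ) :
    |cutoff ε t - cutoff ε t'| ≤ |t - t'| / ε := by
  unfold cutoff
  calc |max 0 (min 1 ((t - ε) / ε)) - max 0 (min 1 ((t' - ε) / ε))|
      ≤ max |(0:ℝ) - 0| |min 1 ((t - ε) / ε) - min 1 ((t' - ε) / ε)| := abs_max_sub_max_le_max _ _ _ _
    _ ≤ max |(0:ℝ) - 0| (max |(1:ℝ) - 1| |(t - ε) / ε - (t' - ε) / ε|) := by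
        gcongr; exact abs_min_sub_min_le_max _ _ _ _
    _ = |t - t'| / ε := by
        rw [show (t - ε) / ε - (t' - ε) / ε = (t - t') / ε by ring, abs_div, abs_of_pos hε]
        have hx : 0 ≤ |t - t'| / ε := by positivity
        simp [max_eq_right hx]

/-- `g(2) = 0` since `C_G(1) = ∫₀⁰ = 0`. [cite: BondarenkoHeap2026, §5 (18)] -/
private theorem gProfile_two (κ : ℝ) (G₀ : Polynomial ℝ) : gProfile κ G₀ 2 = 0 := by
  simp [gProfile, cG]

/-- Bounds and Lipschitz constant of `g` on `[ε, 2]`. [cite: BondarenkoHeap2026, §5 (18)] -/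
private theorem gProfile_bounds {κ ε : ℝ} (hκ : 0 ≤ κ) (hε : 0 < ε) (G₀ : Polynomial ℝ) :
    ∃ M : ℝ, 0 ≤ M ∧ (∀ s ∈ Set.Icc ε 2, |gProfile κ G₀ s| ≤ M * κ / 2) ∧
      (∀ s ∈ Set.Ioc (0:ℝ) 2, |gProfile κ G₀ s| ≤ M * κ / 2) ∧
      ∀ s ∈ Set.Icc ε 2, ∀ s' ∈ Set.Icc ε 2,
        |gProfile κ G₀ s - gProfile κ G₀ s'| ≤ (M / (2 * ε) + M * κ / (2 * ε) + M / ε ^ 2) * |s - s'| := by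
  obtain ⟨M, hM0, hB, hL⟩ := cG_bound_lipschitz G₀
  have hbound : ∀ s ∈ Set.Ioc (0:ℝ) 2, |gProfile κ G₀ s| ≤ M * κ / 2 := by
    intro s hs
    have hs0 : 0 < s := hs.1
    have hs2 : s / 2 ∈ Set.Icc (0:ℝ) 1 := ⟨by linarith, by linarith [hs.2]⟩
    rw [gProfile, abs_div, abs_mul, abs_of_pos hs0, div_le_iff₀ hs0]
    calc |cG G₀ (s / 2)| * |Real.sin (κ * s / 2)| ≤ M * |κ * s / 2| :=
          mul_le_mul (hB _ hs2) (Real.abs_sin_le_abs) (abs_nonneg _) hM0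
      _ = M * κ / 2 * s := by rw [abs_of_nonneg (by positivity)]; ring
  refine ⟨M, hM0, fun s hs => hbound s ⟨lt_of_lt_of_le hε hs.1, hs.2⟩, hbound, fun s hs s' hs' => ?_⟩
  have hs0 : 0 < s := lt_of_lt_of_le hε hs.1
  have hs0' : 0 < s' := lt_of_lt_of_le hε hs'.1
  have hs2 : s / 2 ∈ Set.Icc (0:ℝ) 1 := ⟨by linarith, by linarith [hs.2]⟩
  have hs2' : s' / 2 ∈ Set.Icc (0:ℝ) 1 := ⟨by linarith, by linarith [hs'.2]⟩
  -- A, B, C and their bounds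
  set A := cG G₀ (s / 2); set A' := cG G₀ (s' / 2)
  set B := Real.sin (κ * s / 2); set B' := Real.sin (κ * s' / 2)
  have hA' : |A'| ≤ M := hB _ hs2'
  have hBle : |B| ≤ 1 := Real.abs_sin_le_one _
  have hB'le : |B'| ≤ 1 := Real.abs_sin_le_one _
  have hAA : |A - A'| ≤ M / 2 * |s - s'| := by
    calc |A - A'| ≤ M * |s / 2 - s' / 2| := hL _ hs2 _ hs2'
      _ = M / 2 * |s - s'| := by rw [show s / 2 - s' / 2 = (s - s') / 2 by ring, abs_div, abs_two]; ring
  have hBB : |B - B'| ≤ κ / 2 * |s - s'| := by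
    calc |B - B'| ≤ |κ * s / 2 - κ * s' / 2| := abs_sin_sub_sin_le _ _
      _ = κ / 2 * |s - s'| := by
          rw [show κ * s / 2 - κ * s' / 2 = (κ / 2) * (s - s') by ring, abs_mul, abs_of_nonneg (by positivity)]
  have hCC : |1 / s - 1 / s'| ≤ 1 / ε ^ 2 * |s - s'| := by
    rw [div_sub_div _ _ hs0.ne' hs0'.ne', one_mul, mul_one, abs_div, abs_mul, abs_of_pos hs0, abs_of_pos hs0',
      abs_sub_comm]
    rw [div_le_iff₀ (by positivity)]
    calc |s - s'| = 1 / ε ^ 2 * |s - s'| * (ε * ε) := by field_simp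
      _ ≤ 1 / ε ^ 2 * |s - s'| * (s * s') :=
          mul_le_mul_of_nonneg_left (mul_le_mul hs.1 hs'.1 hε.le hs0.le) (by positivity)
  have hC : |1 / s| ≤ 1 / ε := by
    rw [abs_of_pos (by positivity)]; exact one_div_le_one_div_of_le hε hs.1
  have hC' : |1 / s'| ≤ 1 / ε := by
    rw [abs_of_pos (by positivity)]; exact one_div_le_one_div_of_le hε hs'.1
  -- the three-term identity
  have hid : gProfile κ G₀ s - gProfile κ G₀ s' =
      (A - A') * B * (1 / s) + A' * (B - B') * (1 / s) + A' * B' * (1 / s - 1 / s') := by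
    simp only [gProfile, A, A', B, B']; ring
  rw [hid]
  calc |(A - A') * B * (1 / s) + A' * (B - B') * (1 / s) + A' * B' * (1 / s - 1 / s')|
      ≤ |(A - A') * B * (1 / s)| + |A' * (B - B') * (1 / s)| + |A' * B' * (1 / s - 1 / s')| :=
        abs_add_three _ _ _
    _ = |A - A'| * |B| * |1 / s| + |A'| * |B - B'| * |1 / s| + |A'| * |B'| * |1 / s - 1 / s'| := by
        simp only [abs_mul]
    _ ≤ (M / 2 * |s - s'|) * 1 * (1 / ε) + M * (κ / 2 * |s - s'|) * (1 / ε) +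
          M * 1 * (1 / ε ^ 2 * |s - s'|) := by
        gcongr
    _ = (M / (2 * ε) + M * κ / (2 * ε) + M / ε ^ 2) * |s - s'| := by ring

/-- **Properties of the weight `F`**: bounded by `S = Mκ/2`, `K`-Lipschitz with
`K = S/ε + K_g`, supported in `[ε, 2]`, equal to `g` on `[2ε, 2]`, dominated by `|g|` on
`[ε, 2ε]`, and `F = cutoff · g` on `[0, 2]`. [cite: BondarenkoHeap2026, §5 (18)] -/
private theorem fordWeight_props {κ ε : ℝ} (hκ : 0 ≤ κ) (hε : 0 < ε) (hε1 : ε ≤ 1)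
    (G₀ : Polynomial ℝ) :
    ∃ S K : ℝ, 0 ≤ S ∧ 0 ≤ K ∧
      (∀ t, |fordWeight κ ε G₀ t| ≤ S) ∧
      (∀ t t', |fordWeight κ ε G₀ t - fordWeight κ ε G₀ t'| ≤ K * |t - t'|) ∧
      (∀ t, fordWeight κ ε G₀ t ≠ 0 → ε ≤ t ∧ t ≤ 2) ∧
      (∀ t ∈ Set.Icc (2 * ε) 2, fordWeight κ ε G₀ t = gProfile κ G₀ t) ∧
      (∀ t ∈ Set.Icc (0:ℝ) 2, fordWeight κ ε G₀ t = cutoff ε t * gProfile κ G₀ t) ∧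
      (∀ t ∈ Set.Ioc (0:ℝ) 2, |gProfile κ G₀ t| ≤ S) := by
  have hε2 : ε ≤ 2 := by linarith
  obtain ⟨M, hM0, hgB, hgB', hgL⟩ := gProfile_bounds hκ hε G₀
  set S : ℝ := M * κ / 2 with hS
  set Kg : ℝ := M / (2 * ε) + M * κ / (2 * ε) + M / ε ^ 2 with hKg
  have hS0 : 0 ≤ S := by positivity
  have hKg0 : 0 ≤ Kg := by positivity
  refine ⟨S, S / ε + Kg, hS0, by positivity, ?_, ?_, ?_, ?_, ?_, hgB'⟩
  · -- bound
    intro t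
    have hc := cutoff_mem ε t
    rw [fordWeight, abs_mul, abs_of_nonneg hc.1]
    calc cutoff ε t * |gProfile κ G₀ (clampI ε t)| ≤ 1 * S :=
          mul_le_mul hc.2 (hgB _ (clampI_mem hε2 t)) (abs_nonneg _) zero_le_one
      _ = S := one_mul _
  · -- Lipschitz
    intro t t'
    have hc := cutoff_mem ε t
    have hc' := cutoff_mem ε t'
    have hid : fordWeight κ ε G₀ t - fordWeight κ ε G₀ t' =
        cutoff ε t * (gProfile κ G₀ (clampI ε t) - gProfile κ G₀ (clampI ε t')) +
          (cutoff ε t - cutoff ε t') * gProfile κ G₀ (clampI ε t') := by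
      simp only [fordWeight]; ring
    rw [hid]
    calc |cutoff ε t * (gProfile κ G₀ (clampI ε t) - gProfile κ G₀ (clampI ε t')) +
          (cutoff ε t - cutoff ε t') * gProfile κ G₀ (clampI ε t')|
        ≤ |cutoff ε t| * |gProfile κ G₀ (clampI ε t) - gProfile κ G₀ (clampI ε t')| +
          |cutoff ε t - cutoff ε t'| * |gProfile κ G₀ (clampI ε t')| := by
          refine (abs_add_le _ _).trans ?_
          rw [abs_mul, abs_mul]
      _ ≤ 1 * (Kg * |clampI ε t - clampI ε t'|) + |t - t'| / ε * S := by
          gcongr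
          · rw [abs_of_nonneg hc.1]; exact hc.2
          · exact hgL _ (clampI_mem hε2 t) _ (clampI_mem hε2 t')
          · exact abs_cutoff_sub_le hε t t'
          · exact hgB _ (clampI_mem hε2 t')
      _ ≤ 1 * (Kg * |t - t'|) + |t - t'| / ε * S :=
          add_le_add_left (mul_le_mul_of_nonneg_left
            (mul_le_mul_of_nonneg_left (abs_clampI_sub_le ε t t') hKg0) zero_le_one) _
      _ = (S / ε + Kg) * |t - t'| := by ring
  · -- support
    intro t ht
    by_contra hnot
    rw [not_and_or, not_le, not_le] at hnot
    apply ht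
    rcases hnot with h | h
    · rw [fordWeight, cutoff_of_le hε h.le, zero_mul]
    · rw [fordWeight]
      have : clampI ε t = 2 := by
        unfold clampI; rw [min_eq_right h.le, max_eq_right hε2]
      rw [this, gProfile_two, mul_zero]
  · -- equal to g on [2ε, 2]
    intro t ht
    rw [fordWeight, cutoff_of_ge hε ht.1, one_mul, clampI_of_mem ⟨by linarith [ht.1], ht.2⟩]
  · -- F = cutoff · g on [0,2]
    intro t ht
    rw [fordWeight]
    by_cases h : t ≤ ε
    · rw [cutoff_of_le hε h, zero_mul, zero_mul]
    · rw [clampI_of_mem ⟨le_of_lt (not_le.mp h), ht.2⟩]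


/-! ### §5 (18) holds -/

set_option maxHeartbeats 1600000 in
open scoped Chebyshev in
open Literature.NumberTheory.Sieve.Ford2004 Literature.NumberTheory.Sieve in
/-- **(18) holds**: `∑_{p ⩽ L} (1/p) C_G(log p/log L) sin(πc log p/log T) → ∫₀¹ C_G(u) sin(πcϑu)/u du`
(`L = q^{17/6}`, `T = q^{7/3+δ}`, `q → ∞`), by the prime number theorem with the de la Vallée Poussin
error term (tree: `ChebyshevThetaDeLaValleePoussin_holds`) and partial summation in Ford's packaged
form (tree: `Ford2004.longSum_est`, with `x = q^{17/12}`, `t_p = log p/log x = 2 log p/log L` and the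
Lipschitz weight `F(t) = cutoff_ε(t) · C_G(t/2) sin(πcϑt/2)/t`), Mertens' bound for the primes
`p ⩽ L^ε` and `∫₀² C_G(t/2) sin(πcϑt/2)/t dt = ∫₀¹ C_G(u) sin(πcϑu)/u du`.
[cite: BondarenkoHeap2026, §5 (18)] -/
theorem eq18_holds_aux (ρ : Resonator) (c : ℝ) (hc : 0 < c) (η : ℝ) (hη : 0 < η) :
    ∃ q₀ : ℕ, ∀ q : ℕ, q₀ ≤ q →
      |(∑ p ∈ (Finset.Iic ⌊lengthL q⌋₊).filter Nat.Prime,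
          1 / (p : ℝ) * cG ρ.G₀ (Real.log p / Real.log (lengthL q)) *
            Real.sin (π * c * Real.log p / Real.log (ρ.T q))) -
        sineIntegralCG ρ.δ c ρ.G₀| ≤ η := by
  classical
  -- fixed data
  set ϑ := theta ρ.δ with hϑdef
  have hϑ : 0 < ϑ := by rw [hϑdef, theta]; have := ρ.δ_pos; positivity
  set κ : ℝ := π * c * ϑ with hκdef
  have hκ : 0 < κ := by positivity
  set G₀ := ρ.G₀ with hG₀
  -- PNT input
  obtain ⟨cF, hcF, CF, hPNT⟩ := ChebyshevThetaDeLaValleePoussin_holds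
  -- a priori bound S of the profile (independent of ε): from ε = 1
  obtain ⟨S₁, -, hS₁0, -, -, -, -, -, -, hgS⟩ := fordWeight_props hκ.le one_pos le_rfl G₀
  -- choose ε
  set ε : ℝ := min (1 / 2) (η / (12 * S₁ + 1)) with hεdef
  have hε : 0 < ε := by rw [hεdef]; positivity
  have hε1 : ε ≤ 1 := (min_le_left _ _).trans (by norm_num)
  have hε12 : ε ≤ 1 / 2 := min_le_left _ _
  have hεη : 6 * S₁ * ε ≤ η / 2 := by
    have h1 : ε ≤ η / (12 * S₁ + 1) := min_le_right _ _
    have h2 : 6 * S₁ * ε ≤ 6 * S₁ * (η / (12 * S₁ + 1)) := mul_le_mul_of_nonneg_left h1 (by positivity)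
    refine h2.trans ?_
    rw [mul_div_assoc', div_le_iff₀ (by positivity)]
    nlinarith
  -- the weight and its constants
  obtain ⟨S, K, hS0, hK0, hFS, hFK, hFsupp, hFeq, hFcut, hgS'⟩ := fordWeight_props hκ.le hε hε1 G₀
  set Fr : ℝ → ℝ := fordWeight κ ε G₀ with hFr
  set F : ℝ → ℂ := fun t => ((Fr t : ℝ) : ℂ) with hFdef
  set c₁ : ℝ := cF * Real.sqrt ε / 4 with hc₁
  have hc₁0 : 0 < c₁ := by positivity
  -- thresholds on log q
  set EB : ℝ := A₁ CF ε * S + A₂ CF * K with hEB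
  set W : ℝ := Real.log (8 * (|EB| + 1) / η) / c₁ with hW
  set Z : ℝ := max (max (Real.log 3) (12 / 17 * (2 * Real.log 2 / ε)))
    (max (12 / 17 * W ^ 2) (6 / 17 * (32 * S₁ * Real.log 4 / η))) with hZ
  refine ⟨⌈Real.exp Z⌉₊, fun q hq => ?_⟩
  -- consequences of q ≥ q₀
  have hqZ : Z ≤ Real.log q := by
    have h1 : Real.exp Z ≤ q := (Nat.le_ceil _).trans (by exact_mod_cast hq)
    have := Real.log_le_log (Real.exp_pos Z) h1
    rwa [Real.log_exp] at this
  have hlog3 : Real.log 3 ≤ Real.log q := le_trans ((le_max_left _ _).trans (le_max_left _ _)) hqZ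
  have hq3 : (3 : ℝ) ≤ q := by
    by_contra h
    rw [not_le] at h
    have hlog3pos : 0 < Real.log 3 := Real.log_pos (by norm_num)
    rcases Nat.eq_zero_or_pos q with hq0 | hqpos
    · rw [hq0, Nat.cast_zero, Real.log_zero] at hlog3; linarith
    · have : Real.log q < Real.log 3 := Real.log_lt_log (by exact_mod_cast hqpos) h
      linarith
  have hq0 : (0 : ℝ) < q := by linarith
  have hq1 : (1 : ℝ) ≤ q := by linarith
  have hq2 : 2 ≤ q := by exact_mod_cast (show (2 : ℝ) ≤ q by linarith)
  have hlogq : 0 < Real.log q := Real.log_pos (by linarith)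
  -- x, L, T
  set x : ℝ := (q : ℝ) ^ (17 / 12 : ℝ) with hxdef
  have hx0 : 0 < x := Real.rpow_pos_of_pos hq0 _
  have hlogx : Real.log x = 17 / 12 * Real.log q := by rw [hxdef, Real.log_rpow hq0]
  have hL : lengthL q = x ^ 2 := by
    rw [lengthL, hxdef, ← Real.rpow_natCast, ← Real.rpow_mul hq0.le]; norm_num
  have hLpos : 0 < lengthL q := by rw [hL]; positivity
  have hlogL : Real.log (lengthL q) = 2 * Real.log x := by
    rw [lengthL, Real.log_rpow hq0, hlogx]; ring
  have hlogL0 : 0 < Real.log (lengthL q) := by rw [hlogL, hlogx]; positivity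
  have hlogT0 : 0 < Real.log (ρ.T q) := by
    rw [Resonator.T, Real.log_rpow hq0]; have := ρ.δ_pos; positivity
  have hϑeq : Real.log (lengthL q) / Real.log (ρ.T q) = ϑ := theta_eq ρ hq2
  -- Ford's hypotheses on x
  have hxe : Real.exp 1 ≤ x := by
    have h1 : Real.exp 1 ≤ 3 := by have := Real.exp_one_lt_d9; linarith
    have h2 : (3 : ℝ) ≤ x := by
      calc (3 : ℝ) ≤ q := hq3
        _ = (q : ℝ) ^ (1 : ℝ) := (Real.rpow_one _).symm
        _ ≤ x := Real.rpow_le_rpow_of_exponent_le hq1 (by norm_num)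
    exact h1.trans h2
  have hx2 : 2 ≤ x ^ (ε / 2) := by
    have hZ2 : 12 / 17 * (2 * Real.log 2 / ε) ≤ Real.log q :=
      le_trans ((le_max_right _ _).trans (le_max_left _ _)) hqZ
    have hlog2 : Real.log 2 ≤ Real.log (x ^ (ε / 2)) := by
      rw [Real.log_rpow hx0, hlogx]
      rw [show 12 / 17 * (2 * Real.log 2 / ε) = (2 * Real.log 2 / ε) * (12 / 17) by ring] at hZ2
      have : 2 * Real.log 2 / ε * (12 / 17) * (17 / 12) ≤ Real.log q * (17 / 12) :=
        mul_le_mul_of_nonneg_right hZ2 (by norm_num)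
      have h' : 2 * Real.log 2 ≤ ε * (17 / 12 * Real.log q) := by
        rw [div_mul_eq_mul_div, div_mul_eq_mul_div, div_le_iff₀ hε] at this
        linarith
      calc Real.log 2 = (2 * Real.log 2) / 2 := by ring
        _ ≤ ε * (17 / 12 * Real.log q) / 2 := by gcongr
        _ = ε / 2 * (17 / 12 * Real.log q) := by ring
    exact (Real.log_le_log_iff (by norm_num) (Real.rpow_pos_of_pos hx0 _)).mp hlog2
  -- Ford
  have hFS' : ∀ t, ‖F t‖ ≤ S := fun t => by rw [hFdef]; simp only [Complex.norm_real]; exact hFS t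
  have hFK' : ∀ t t', ‖F t - F t'‖ ≤ K * |t - t'| := fun t t' => by
    rw [hFdef]; simp only [← Complex.ofReal_sub, Complex.norm_real]; exact hFK t t'
  have hFsupp' : ∀ t, F t ≠ 0 → ε ≤ t ∧ t ≤ 2 := fun t ht => hFsupp t (by
    rw [hFdef] at ht; simpa using ht)
  have hFord := longSum_est hcF hPNT hε hε1 hxe hx2 hc₁0 le_rfl F hFS' hFK' hFsupp'
  -- Ford error is small
  have hEB0 : 0 ≤ (A₁ CF ε * S + A₂ CF * K) * eta c₁ x := le_trans (norm_nonneg _) hFord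
  have hEBsmall : (A₁ CF ε * S + A₂ CF * K) * eta c₁ x ≤ η / 8 := by
    have hZ3 : 12 / 17 * W ^ 2 ≤ Real.log q := le_trans ((le_max_left _ _).trans (le_max_right _ _)) hqZ
    have hW2 : W ^ 2 ≤ Real.log x := by rw [hlogx]; linarith
    have hWle : W ≤ Real.sqrt (Real.log x) := by
      rcases le_or_gt 0 W with hW0 | hW0
      · calc W = Real.sqrt (W ^ 2) := (Real.sqrt_sq hW0).symm
          _ ≤ Real.sqrt (Real.log x) := Real.sqrt_le_sqrt hW2
      · exact hW0.le.trans (Real.sqrt_nonneg _)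
    -- eta c₁ x = exp(-c₁ √log x) ≤ exp(-c₁ W) = η/(8(|EB|+1))
    have heta : eta c₁ x ≤ η / (8 * (|EB| + 1)) := by
      rw [Literature.NumberTheory.Sieve.Ford2004.eta]
      have h1 : -(c₁ * Real.sqrt (Real.log x)) ≤ -(c₁ * W) := by
        have := mul_le_mul_of_nonneg_left hWle hc₁0.le; linarith
      calc Real.exp (-(c₁ * Real.sqrt (Real.log x))) ≤ Real.exp (-(c₁ * W)) := Real.exp_le_exp.mpr h1
        _ = η / (8 * (|EB| + 1)) := by
            rw [hW, mul_div_cancel₀ _ hc₁0.ne', Real.exp_neg, Real.exp_log (by positivity), inv_div]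
    calc (A₁ CF ε * S + A₂ CF * K) * eta c₁ x = EB * eta c₁ x := by rw [hEB]
      _ ≤ |EB| * eta c₁ x := mul_le_mul_of_nonneg_right (le_abs_self _) (eta_pos _ _).le
      _ ≤ |EB| * (η / (8 * (|EB| + 1))) := mul_le_mul_of_nonneg_left heta (abs_nonneg _)
      _ = (|EB| / (|EB| + 1)) * (η / 8) := by field_simp
      _ ≤ 1 * (η / 8) := by
          gcongr
          rw [div_le_one (by positivity)]; linarith
      _ = η / 8 := one_mul _
  -- the prime sets agree, and `⌊x²⌋ = ⌊L⌋`
  set N : ℕ := ⌊lengthL q⌋₊ with hN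
  have hx2L : x ^ 2 = lengthL q := hL.symm
  have hPeq : (Finset.Iic N).filter Nat.Prime = primesIn 0 N := by
    ext p
    simp only [Finset.mem_filter, Finset.mem_Iic, primesIn, Finset.mem_Ioc]
    constructor
    · rintro ⟨h1, h2⟩; exact ⟨⟨h2.pos, h1⟩, h2⟩
    · rintro ⟨⟨_, h1⟩, h2⟩; exact ⟨h1, h2⟩
  -- Ford's estimate in real form
  have hFordR : |(∑ p ∈ primesIn 0 N, tOf x p / p * Fr (tOf x p)) - ∫ t, Fr t| ≤ η / 8 := by
    have h := hFord
    rw [hx2L] at h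
    have hcast : (∑ p ∈ primesIn 0 N, ((tOf x p / p : ℝ) : ℂ) * F (tOf x p)) - ∫ t, F t =
        (((∑ p ∈ primesIn 0 N, tOf x p / p * Fr (tOf x p)) - ∫ t, Fr t : ℝ) : ℂ) := by
      rw [hFdef, integral_complex_ofReal]; push_cast; rfl
    rw [hcast, Complex.norm_real, Real.norm_eq_abs] at h
    exact h.trans hEBsmall
  -- notation for the summands
  set uOf : ℕ → ℝ := fun p => Real.log p / Real.log (lengthL q) with huOf
  have htOf : ∀ p : ℕ, tOf x p = 2 * uOf p := by
    intro p; simp only [tOf, huOf, hlogL]; field_simp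
  have hsinarg : ∀ p : ℕ, π * c * Real.log p / Real.log (ρ.T q) = κ * uOf p := by
    intro p
    rw [hκdef, ← hϑeq]
    simp only [huOf]
    field_simp
  -- g(t) · t = C_G(t/2) sin(κt/2)
  have hg_mul : ∀ t : ℝ, t ≠ 0 → cG G₀ (t / 2) * Real.sin (κ * t / 2) = t * gProfile κ G₀ t := by
    intro t ht; rw [gProfile]; field_simp
  -- per-prime comparison
  have hterm : ∀ p ∈ primesIn 0 N,
      |1 / (p : ℝ) * cG G₀ (uOf p) * Real.sin (κ * uOf p) - tOf x p / p * Fr (tOf x p)| ≤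
        if p ≤ ⌊(lengthL q) ^ ε⌋₊ then 4 * S₁ * uOf p / p else 0 := by
    intro p hp
    obtain ⟨hpp, hp0, hpN⟩ := mem_primesIn.mp hp
    have hp2 : (2 : ℝ) ≤ p := by exact_mod_cast hpp.two_le
    have hp0r : (0 : ℝ) < p := by linarith
    have hpL : (p : ℝ) ≤ lengthL q := le_trans (by exact_mod_cast hpN) (Nat.floor_le hLpos.le)
    have hu0 : 0 < uOf p := by simp only [huOf]; exact div_pos (Real.log_pos (by linarith)) hlogL0
    have hu1 : uOf p ≤ 1 := by
      simp only [huOf]; rw [div_le_one hlogL0]; exact Real.log_le_log hp0r hpL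
    have ht0 : 0 < tOf x p := by rw [htOf]; linarith
    have ht2 : tOf x p ≤ 2 := by rw [htOf]; linarith
    have htI : tOf x p ∈ Set.Ioc (0:ℝ) 2 := ⟨ht0, ht2⟩
    -- a p rewritten through g
    have ha : 1 / (p : ℝ) * cG G₀ (uOf p) * Real.sin (κ * uOf p) = tOf x p / p * gProfile κ G₀ (tOf x p) := by
      have := hg_mul (tOf x p) ht0.ne'
      rw [show tOf x p / 2 = uOf p by rw [htOf]; ring, show κ * tOf x p / 2 = κ * uOf p by rw [htOf]; ring] at this
      rw [mul_assoc, this]; ring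
    rw [ha]
    split_ifs with hsmall
    · -- small primes: both terms are ≤ 2 S₁ u_p / p
      have hgb : |gProfile κ G₀ (tOf x p)| ≤ S₁ := hgS _ htI
      have hFb : |Fr (tOf x p)| ≤ S₁ := by
        rw [hFcut _ ⟨ht0.le, ht2⟩, abs_mul, abs_of_nonneg (cutoff_mem ε _).1]
        calc cutoff ε (tOf x p) * |gProfile κ G₀ (tOf x p)| ≤ 1 * S₁ :=
              mul_le_mul (cutoff_mem ε _).2 hgb (abs_nonneg _) zero_le_one
          _ = S₁ := one_mul _
      have htp : 0 ≤ tOf x p / p := by positivity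
      calc |tOf x p / p * gProfile κ G₀ (tOf x p) - tOf x p / p * Fr (tOf x p)|
          ≤ |tOf x p / p * gProfile κ G₀ (tOf x p)| + |tOf x p / p * Fr (tOf x p)| := abs_sub _ _
        _ = tOf x p / p * |gProfile κ G₀ (tOf x p)| + tOf x p / p * |Fr (tOf x p)| := by
            rw [abs_mul, abs_mul, abs_of_nonneg htp]
        _ ≤ tOf x p / p * S₁ + tOf x p / p * S₁ := by gcongr
        _ = 4 * S₁ * uOf p / p := by rw [htOf]; ring
    · -- large primes: the two terms coincide
      have hpgt : ⌊(lengthL q) ^ ε⌋₊ < p := not_le.mp hsmall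
      have hpε : (lengthL q) ^ ε < p := Nat.lt_of_floor_lt hpgt
      have huε : ε < uOf p := by
        simp only [huOf]
        rw [lt_div_iff₀ hlogL0]
        have := Real.log_lt_log (Real.rpow_pos_of_pos hLpos ε) hpε
        rwa [Real.log_rpow hLpos] at this
      have ht2ε : 2 * ε ≤ tOf x p := by rw [htOf]; linarith
      rw [hFeq _ ⟨ht2ε, ht2⟩, sub_self, abs_zero]
  -- the sum of the per-prime bounds (Mertens)
  have hEA : ∑ p ∈ primesIn 0 N, (if p ≤ ⌊(lengthL q) ^ ε⌋₊ then 4 * S₁ * uOf p / p else 0) ≤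
      4 * S₁ * ε + η / 8 := by
    rw [← Finset.sum_filter]
    have hsub : (primesIn 0 N).filter (fun p => p ≤ ⌊(lengthL q) ^ ε⌋₊) ⊆ Nat.primesLE ⌊(lengthL q) ^ ε⌋₊ := by
      intro p hp
      rw [Finset.mem_filter] at hp
      exact Nat.mem_primesLE.mpr ⟨hp.2, (mem_primesIn.mp hp.1).1⟩
    have h1 : ∑ p ∈ (primesIn 0 N).filter (fun p => p ≤ ⌊(lengthL q) ^ ε⌋₊), 4 * S₁ * uOf p / p ≤
        ∑ p ∈ Nat.primesLE ⌊(lengthL q) ^ ε⌋₊, 4 * S₁ * uOf p / p := by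
      refine Finset.sum_le_sum_of_subset_of_nonneg hsub fun p hp _ => ?_
      have hpp := (Nat.mem_primesLE.mp hp).2
      have : 0 ≤ uOf p := by simp only [huOf]; exact div_nonneg (Real.log_nonneg (by exact_mod_cast hpp.one_lt.le)) hlogL0.le
      positivity
    have h2 : ∑ p ∈ Nat.primesLE ⌊(lengthL q) ^ ε⌋₊, 4 * S₁ * uOf p / p =
        4 * S₁ / Real.log (lengthL q) * ∑ p ∈ Nat.primesLE ⌊(lengthL q) ^ ε⌋₊, Real.log p / p := by
      rw [Finset.mul_sum]
      refine Finset.sum_congr rfl fun p _ => ?_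
      simp only [huOf]; field_simp
    have h3 := Literature.NumberTheory.LFunctions.MertensBound.sum_log_div_prime_le ⌊(lengthL q) ^ ε⌋₊
    have hLε0 : 0 < (lengthL q) ^ ε := Real.rpow_pos_of_pos hLpos ε
    have hL1 : 1 ≤ lengthL q := by
      have hx1 : 1 ≤ x := le_trans (by have := Real.add_one_le_exp (1:ℝ); linarith) hxe
      rw [hL]; exact one_le_pow₀ hx1
    have h4 : Real.log (⌊(lengthL q) ^ ε⌋₊ : ℕ) ≤ ε * Real.log (lengthL q) := by
      rw [← Real.log_rpow hLpos ε]
      rcases Nat.eq_zero_or_pos ⌊(lengthL q) ^ ε⌋₊ with h0 | hpos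
      · rw [h0, Nat.cast_zero, Real.log_zero]
        exact Real.log_nonneg (Real.one_le_rpow hL1 hε.le)
      · exact Real.log_le_log (by exact_mod_cast hpos) (Nat.floor_le hLε0.le)
    have hlog4 : 4 * S₁ * Real.log 4 / Real.log (lengthL q) ≤ η / 8 := by
      have hZ4 : 6 / 17 * (32 * S₁ * Real.log 4 / η) ≤ Real.log q :=
        le_trans ((le_max_right _ _).trans (le_max_right _ _)) hqZ
      have hlogL' : Real.log (lengthL q) = 17 / 6 * Real.log q := by rw [lengthL, Real.log_rpow hq0]
      rw [div_le_iff₀ hlogL0, hlogL']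
      have h6 : 32 * S₁ * Real.log 4 / η ≤ 17 / 6 * Real.log q := by linarith
      rw [div_le_iff₀ hη] at h6
      calc 4 * S₁ * Real.log 4 = (32 * S₁ * Real.log 4) / 8 := by ring
        _ ≤ (17 / 6 * Real.log q * η) / 8 := by gcongr
        _ = η / 8 * (17 / 6 * Real.log q) := by ring
    calc ∑ p ∈ (primesIn 0 N).filter (fun p => p ≤ ⌊(lengthL q) ^ ε⌋₊), 4 * S₁ * uOf p / p
        ≤ 4 * S₁ / Real.log (lengthL q) * ∑ p ∈ Nat.primesLE ⌊(lengthL q) ^ ε⌋₊, Real.log p / p := h1.trans h2.le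
      _ ≤ 4 * S₁ / Real.log (lengthL q) * (Real.log (⌊(lengthL q) ^ ε⌋₊ : ℕ) + Real.log 4) := by gcongr
      _ ≤ 4 * S₁ / Real.log (lengthL q) * (ε * Real.log (lengthL q) + Real.log 4) := by gcongr
      _ = 4 * S₁ * ε + 4 * S₁ * Real.log 4 / Real.log (lengthL q) := by field_simp
      _ ≤ 4 * S₁ * ε + η / 8 := by linarith
  -- E_A: the two prime sums are close
  have hsumA : |(∑ p ∈ primesIn 0 N, 1 / (p : ℝ) * cG G₀ (uOf p) * Real.sin (κ * uOf p)) -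
      ∑ p ∈ primesIn 0 N, tOf x p / p * Fr (tOf x p)| ≤ 4 * S₁ * ε + η / 8 := by
    rw [← Finset.sum_sub_distrib]
    refine (Finset.abs_sum_le_sum_abs _ _).trans ((Finset.sum_le_sum hterm).trans hEA)
  -- E_C: the integral of F is close to the sine integral
  have hcut_cont : Continuous (cutoff ε) := by
    unfold cutoff
    exact continuous_const.max (continuous_const.min ((continuous_id.sub continuous_const).div_const ε))
  have hgmeas : Measurable (gProfile κ G₀) := by
    have h1 : Measurable fun t : ℝ => cG G₀ (t / 2) := (continuous_cG G₀).measurable.comp (measurable_id.div_const 2)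
    have h2 : Measurable fun t : ℝ => Real.sin (κ * t / 2) :=
      Real.measurable_sin.comp ((measurable_const.mul measurable_id).div_const 2)
    exact (h1.mul h2).div measurable_id
  have hgint : IntervalIntegrable (gProfile κ G₀) volume 0 2 := by
    rw [intervalIntegrable_iff, Set.uIoc_of_le (by norm_num : (0:ℝ) ≤ 2)]
    refine Measure.integrableOn_of_bounded (M := S₁) (by simp [Real.volume_Ioc]) hgmeas.aestronglyMeasurable ?_
    exact (ae_restrict_iff' measurableSet_Ioc).mpr (ae_of_all _ fun t ht => by
      rw [Real.norm_eq_abs]; exact hgS t ht)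
  have hcgint : IntervalIntegrable (fun t => cutoff ε t * gProfile κ G₀ t) volume 0 2 :=
    hgint.continuousOn_mul hcut_cont.continuousOn
  have hIF : ∫ t, Fr t = ∫ t in (0:ℝ)..2, cutoff ε t * gProfile κ G₀ t := by
    have hsup : Function.support Fr ⊆ Set.Ioc (0:ℝ) 2 := by
      intro t ht
      obtain ⟨h1, h2⟩ := hFsupp t ht
      exact ⟨lt_of_lt_of_le hε h1, h2⟩
    rw [← intervalIntegral.integral_eq_integral_of_support_subset hsup]
    refine intervalIntegral.integral_congr fun t ht => ?_
    rw [Set.uIcc_of_le (by norm_num : (0:ℝ) ≤ 2)] at ht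
    exact hFcut t ht
  have hISI : sineIntegralCG ρ.δ c G₀ = ∫ t in (0:ℝ)..2, gProfile κ G₀ t := by
    have hgf : ∀ t : ℝ, gProfile κ G₀ t =
        (fun u : ℝ => cG G₀ u * Real.sin (κ * u) / (2 * u)) (t / 2) := by
      intro t; simp only [gProfile]; ring_nf
    rw [intervalIntegral.integral_congr (fun t _ => hgf t),
      intervalIntegral.integral_comp_div (fun u : ℝ => cG G₀ u * Real.sin (κ * u) / (2 * u)) two_ne_zero,
      zero_div, show (2:ℝ) / 2 = 1 by norm_num, sineIntegralCG, smul_eq_mul, ← intervalIntegral.integral_const_mul]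
    refine intervalIntegral.integral_congr fun u _ => ?_
    simp only [hκdef, hϑdef, hG₀]
    rcases eq_or_ne u 0 with rfl | hu
    · simp
    · field_simp
  have hIC : |(∫ t in (0:ℝ)..2, cutoff ε t * gProfile κ G₀ t) - ∫ t in (0:ℝ)..2, gProfile κ G₀ t| ≤ 2 * ε * S₁ := by
    rw [← intervalIntegral.integral_sub hcgint hgint]
    have hbint : IntervalIntegrable (fun t => S₁ * (1 - cutoff ε t)) volume 0 2 :=
      (continuous_const.mul (continuous_const.sub hcut_cont)).intervalIntegrable _ _
    have h1 : |∫ t in (0:ℝ)..2, (cutoff ε t * gProfile κ G₀ t - gProfile κ G₀ t)| ≤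
        ∫ t in (0:ℝ)..2, S₁ * (1 - cutoff ε t) := by
      have := intervalIntegral.norm_integral_le_of_norm_le (by norm_num : (0:ℝ) ≤ 2)
        (f := fun t => cutoff ε t * gProfile κ G₀ t - gProfile κ G₀ t)
        (ae_of_all _ fun t ht => by
          have hc := cutoff_mem ε t
          rw [Real.norm_eq_abs, show cutoff ε t * gProfile κ G₀ t - gProfile κ G₀ t =
            -((1 - cutoff ε t) * gProfile κ G₀ t) by ring, abs_neg, abs_mul,
            abs_of_nonneg (by linarith [hc.2] : 0 ≤ 1 - cutoff ε t), mul_comm]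
          exact mul_le_mul_of_nonneg_right (hgS t ht) (by linarith [hc.2])) hbint
      rwa [Real.norm_eq_abs] at this
    have hbint' : ∀ a b : ℝ, IntervalIntegrable (fun t => S₁ * (1 - cutoff ε t)) volume a b :=
      fun a b => (continuous_const.mul (continuous_const.sub hcut_cont)).intervalIntegrable a b
    have h2 : ∫ t in (0:ℝ)..2, S₁ * (1 - cutoff ε t) ≤ 2 * ε * S₁ := by
      have hε2 : 2 * ε ≤ 2 := by linarith
      rw [← intervalIntegral.integral_add_adjacent_intervals (hbint' 0 (2 * ε)) (hbint' (2 * ε) 2)]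
      have h3 : ∫ t in (2 * ε)..2, S₁ * (1 - cutoff ε t) = 0 := by
        rw [intervalIntegral.integral_congr (g := fun _ => (0:ℝ)) (fun t ht => by
          rw [Set.uIcc_of_le hε2] at ht
          simp [cutoff_of_ge hε ht.1]), intervalIntegral.integral_zero]
      have h4 : |∫ t in (0:ℝ)..(2 * ε), S₁ * (1 - cutoff ε t)| ≤ S₁ * |2 * ε - 0| := by
        have := intervalIntegral.norm_integral_le_of_norm_le_const (a := 0) (b := 2 * ε)
          (f := fun t => S₁ * (1 - cutoff ε t)) (C := S₁) (fun t _ => by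
            have hc := cutoff_mem ε t
            rw [Real.norm_eq_abs, abs_mul, abs_of_nonneg hS₁0, abs_of_nonneg (by linarith [hc.2] : 0 ≤ 1 - cutoff ε t)]
            exact mul_le_of_le_one_right hS₁0 (by linarith [hc.1]))
        rwa [Real.norm_eq_abs] at this
      rw [h3, add_zero]
      calc ∫ t in (0:ℝ)..(2 * ε), S₁ * (1 - cutoff ε t) ≤ |∫ t in (0:ℝ)..(2 * ε), S₁ * (1 - cutoff ε t)| := le_abs_self _
        _ ≤ S₁ * |2 * ε - 0| := h4
        _ = 2 * ε * S₁ := by rw [sub_zero, abs_of_nonneg (by linarith)]; ring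
    exact h1.trans h2
  -- rewrite the eq18 sum into the `primesIn` form with the `κ u_p` argument
  have hLHS : (∑ p ∈ (Finset.Iic N).filter Nat.Prime,
      1 / (p : ℝ) * cG G₀ (Real.log p / Real.log (lengthL q)) * Real.sin (π * c * Real.log p / Real.log (ρ.T q))) =
      ∑ p ∈ primesIn 0 N, 1 / (p : ℝ) * cG G₀ (uOf p) * Real.sin (κ * uOf p) := by
    rw [hPeq]
    refine Finset.sum_congr rfl fun p _ => ?_
    rw [hsinarg p]
  -- assemble
  rw [hLHS, hISI]
  have hsplit : (∑ p ∈ primesIn 0 N, 1 / (p : ℝ) * cG G₀ (uOf p) * Real.sin (κ * uOf p)) -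
      (∫ t in (0:ℝ)..2, gProfile κ G₀ t) =
      ((∑ p ∈ primesIn 0 N, 1 / (p : ℝ) * cG G₀ (uOf p) * Real.sin (κ * uOf p)) -
        ∑ p ∈ primesIn 0 N, tOf x p / p * Fr (tOf x p)) +
      ((∑ p ∈ primesIn 0 N, tOf x p / p * Fr (tOf x p)) - ∫ t, Fr t) +
      ((∫ t in (0:ℝ)..2, cutoff ε t * gProfile κ G₀ t) - ∫ t in (0:ℝ)..2, gProfile κ G₀ t) := by
    rw [hIF]; ring
  rw [hsplit]
  calc |((∑ p ∈ primesIn 0 N, 1 / (p : ℝ) * cG G₀ (uOf p) * Real.sin (κ * uOf p)) -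
          ∑ p ∈ primesIn 0 N, tOf x p / p * Fr (tOf x p)) +
        ((∑ p ∈ primesIn 0 N, tOf x p / p * Fr (tOf x p)) - ∫ t, Fr t) +
        ((∫ t in (0:ℝ)..2, cutoff ε t * gProfile κ G₀ t) - ∫ t in (0:ℝ)..2, gProfile κ G₀ t)|
      ≤ (4 * S₁ * ε + η / 8) + η / 8 + 2 * ε * S₁ :=
        (abs_add_three _ _ _).trans (add_le_add (add_le_add hsumA hFordR) hIC)
    _ ≤ η := by linarith [hεη]

/-- **(18) holds** — DISCHARGE of the named fact `eq18` of
`BondarenkoHeap2026Sections3to5`. [cite: BondarenkoHeap2026, §5 (18)] -/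
theorem eq18_holds : eq18 := fun ρ c hc η hη => eq18_holds_aux ρ c hc η hη

end Eq18Proof

/-! ### §5. Proposition 5 from (17), Proposition 3, (18) and (3) (PROVED implication)

The printed proof of Proposition 5 (TeX l.655–700): "Taking `km = n` we have
`𝒟 = Ŵ_T(0) Σ_{km ⩽ L} Λ(k)χ(k)χ(m)²G(m)G(km)/(km) · sin(πc log k/log T)/log k`. The contribution
from prime powers is negligible … Then after restricting to `k = p`, for the inner sum … (17) …
Now, the prime number theorem and partial summation give (18) whilst the accumulated error from (17)
is `O(T(log log q)²)` … negligible compared with `T(φ(q)/q) log L`. It then remains to justify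
replacing `χ(p)` by `−1`. By Proposition 3 … `Σ_{p ⩽ L, χ(p) ≠ −1} (1/p)|sin(πc log p/log T)|
≪ log q/(log T √log 𝓔) + o(1) = O(1/√log 𝓔)`. Here `L = q^{17/6} < q^{500}`." -/

section Prop5Proof
/-- For `m ≥ 1`: the multiples of `m` in `[1, N]` are the image of `[1, N/m]` under `k ↦ m k`.
[folklore] -/
private theorem sum_Icc_ite_dvd_eq {M : Type*} [AddCommMonoid M] (f : ℕ → M) {m : ℕ} (hm : 1 ≤ m) (N : ℕ) :
    ∑ n ∈ Icc 1 N, (if m ∣ n then f n else 0) = ∑ k ∈ Icc 1 (N / m), f (m * k) := by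
  rw [← sum_filter]
  have himg : (Icc 1 N).filter (fun n => m ∣ n) = (Icc 1 (N / m)).image (fun k => m * k) := by
    ext n
    simp only [mem_filter, mem_Icc, mem_image]
    constructor
    · rintro ⟨⟨h1, h2⟩, ⟨k, rfl⟩⟩
      refine ⟨k, ⟨?_, ?_⟩, rfl⟩
      · rcases Nat.eq_zero_or_pos k with hk | hk
        · subst hk; simp at h1
        · exact hk
      · exact (Nat.le_div_iff_mul_le hm).mpr (by rw [Nat.mul_comm]; exact h2)
    · rintro ⟨k, ⟨h1, h2⟩, rfl⟩
      refine ⟨⟨?_, ?_⟩, dvd_mul_right _ _⟩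
      · exact le_trans hm (Nat.le_mul_of_pos_right _ h1)
      · have := (Nat.le_div_iff_mul_le hm).mp h2
        rw [Nat.mul_comm]; exact this
  rw [himg, sum_image]
  intro a _ b _ hab
  exact Nat.eq_of_mul_eq_mul_left hm hab

/-- Exchange of the order of summation over `{(m, k) : m, k ≥ 1, m k ≤ N}`. [folklore] -/
private theorem sum_Icc_sum_Icc_div_comm {M : Type*} [AddCommMonoid M] (F : ℕ → ℕ → M) (N : ℕ) :
    ∑ m ∈ Icc 1 N, ∑ k ∈ Icc 1 (N / m), F m k = ∑ k ∈ Icc 1 N, ∑ m ∈ Icc 1 (N / k), F m k := by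
  apply sum_comm'
  intro m k
  simp only [mem_Icc]
  constructor
  · rintro ⟨⟨hm1, hmN⟩, hk1, hkN⟩
    have hmk : k * m ≤ N := (Nat.le_div_iff_mul_le hm1).mp hkN
    refine ⟨⟨hm1, (Nat.le_div_iff_mul_le hk1).mpr (by rw [Nat.mul_comm]; exact hmk)⟩, hk1, ?_⟩
    exact le_trans (Nat.le_mul_of_pos_right _ hm1) hmk
  · rintro ⟨⟨hm1, hmN⟩, hk1, hkN⟩
    have hmk : m * k ≤ N := (Nat.le_div_iff_mul_le hk1).mp hmN
    refine ⟨⟨hm1, le_trans (Nat.le_mul_of_pos_right _ hk1) hmk⟩, hk1,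
      (Nat.le_div_iff_mul_le hm1).mpr (by rw [Nat.mul_comm]; exact hmk)⟩

/-- A diagonal term `jTerm k m (m k)` carries the weight `Ŵ_T(0)` and `√(k·m·mk) = k m`.
[cite: BondarenkoHeap2026, §5 p. 13 (proof of Proposition 5, first display)] -/
theorem jTerm_mul (c : ℝ) (w : Bump) (B : ℕ) (r : ℕ → ℝ) (T : ℝ) {k m : ℕ} (hk : 1 ≤ k)
    (hm : 1 ≤ m) :
    jTerm c w B r T k m (m * k) =
      ArithmeticFunction.vonMangoldt k * gWeight (gapWidth c T) k * r m * r (m * k) / ((k : ℝ) * m) *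
        weightHat w B T 0 := by
  have hk0 : (0 : ℝ) < k := by exact_mod_cast hk
  have hm0 : (0 : ℝ) < m := by exact_mod_cast hm
  rw [jTerm]
  have h1 : Real.log ((k : ℝ) * m / ((m * k : ℕ) : ℝ)) / (2 * π) = 0 := by
    rw [Nat.cast_mul, show (k : ℝ) * m / ((m : ℝ) * k) = 1 by field_simp]
    simp
  have h2 : Real.sqrt ((k : ℝ) * m * ((m * k : ℕ) : ℝ)) = (k : ℝ) * m := by
    rw [Nat.cast_mul, show (k : ℝ) * m * ((m : ℝ) * k) = ((k : ℝ) * m) ^ 2 by ring,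
      Real.sqrt_sq (by positivity)]
  rw [h1, h2]

/-- **"Taking `km = n`"** (§5, TeX l.656–663): `𝒟 = Ŵ_T(0) Σ_{k ≤ N} Σ_{m ≤ N/k} Λ(k) g_h(k) r(m) r(km)/(km)`,
`N = ⌊L⌋`. [cite: BondarenkoHeap2026, §5 p. 13 (proof of Proposition 5, first display)] -/
theorem diagD_eq_sum (c : ℝ) (w : Bump) (B : ℕ) (ρ : Resonator) {q : ℕ} (χ : DirichletCharacter ℂ q) :
    diagD c w B ρ χ = weightHat w B (ρ.T q) 0 *
      ∑ k ∈ Icc 1 ⌊lengthL q⌋₊, ∑ m ∈ Icc 1 (⌊lengthL q⌋₊ / k),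
        ArithmeticFunction.vonMangoldt k * gWeight (gapWidth c (ρ.T q)) k * ρ.coeff χ m *
          ρ.coeff χ (m * k) / ((k : ℝ) * m) := by
  classical
  set N := ⌊lengthL q⌋₊ with hN
  rw [diagD]
  have step1 : ∀ m ∈ Icc 1 N, (∑ n ∈ Icc 1 N,
      if m ∣ n then jTerm c w B (ρ.coeff χ) (ρ.T q) (n / m) m n else 0) =
      ∑ k ∈ Icc 1 (N / m), ArithmeticFunction.vonMangoldt k * gWeight (gapWidth c (ρ.T q)) k *
        ρ.coeff χ m * ρ.coeff χ (m * k) / ((k : ℝ) * m) * weightHat w B (ρ.T q) 0 := by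
    intro m hm
    have hm1 : 1 ≤ m := (mem_Icc.mp hm).1
    rw [sum_Icc_ite_dvd_eq (fun n => jTerm c w B (ρ.coeff χ) (ρ.T q) (n / m) m n) hm1 N]
    refine sum_congr rfl fun k hk => ?_
    have hk1 : 1 ≤ k := (mem_Icc.mp hk).1
    rw [Nat.mul_div_cancel_left k (by omega : 0 < m), jTerm_mul c w B _ _ hk1 hm1]
  rw [sum_congr rfl step1, sum_Icc_sum_Icc_div_comm (fun m k =>
      ArithmeticFunction.vonMangoldt k * gWeight (gapWidth c (ρ.T q)) k *
        ρ.coeff χ m * ρ.coeff χ (m * k) / ((k : ℝ) * m) * weightHat w B (ρ.T q) 0) N, mul_sum]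
  refine sum_congr rfl fun k _ => ?_
  rw [mul_sum]
  refine sum_congr rfl fun m _ => ?_
  ring

/-! ### The inner sum at a prime `k = p` -/

/-- `Λ(p) g_h(p) = sin(πc log p/log T)` (`h = 2πc/log T`). [cite: BondarenkoHeap2026, §5 p. 13 (proof of Proposition 5)] -/
theorem vonMangoldt_mul_gWeight_prime (c T : ℝ) {p : ℕ} (hp : p.Prime) :
    ArithmeticFunction.vonMangoldt p * gWeight (gapWidth c T) p =
      Real.sin (π * c * Real.log p / Real.log T) := by
  have hlogp : Real.log p ≠ 0 := (Real.log_pos (by exact_mod_cast hp.one_lt)).ne'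
  rw [ArithmeticFunction.vonMangoldt_apply_prime hp, gWeight, gapWidth, mul_div_assoc',
    mul_div_cancel_left₀ _ hlogp]
  congr 1
  field_simp

/-- A quadratic character is real: `Im χ(a) = 0`. [folklore] -/
private theorem im_quadratic {q : ℕ} {χ : DirichletCharacter ℂ q} (hχ : χ.IsQuadratic) (a : ZMod q) :
    (χ a).im = 0 := by
  rcases hχ a with h | h | h <;> simp [h]

/-- `χ(m)² = 1_{(m,q)=1}` for a quadratic character (real parts). [folklore] -/
private theorem re_sq_quadratic {q : ℕ} {χ : DirichletCharacter ℂ q} (hχ : χ.IsQuadratic) (m : ℕ) :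
    (χ (m : ZMod q)).re ^ 2 = if m.Coprime q then 1 else 0 := by
  by_cases hm : m.Coprime q
  · have hu : IsUnit ((m : ℕ) : ZMod q) := (ZMod.isUnit_iff_coprime m q).mpr hm
    rw [if_pos hm]
    rcases hχ (m : ZMod q) with h | h | h
    · exact absurd h (hu.map χ).ne_zero
    · simp [h]
    · simp [h]
  · rw [if_neg hm, χ.map_nonunit (mt (ZMod.isUnit_iff_coprime m q).mp hm)]
    simp

/-- `r(m) r(mp) = χ(p) χ(m)² G(m) G(mp)` for the resonator coefficients `r = χ G`, `χ` quadratic.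
[cite: BondarenkoHeap2026, §5 p. 13 (proof of Proposition 5, first display)] -/
theorem coeff_mul_coeff_mul {q : ℕ} {χ : DirichletCharacter ℂ q} (hχ : χ.IsQuadratic)
    (ρ : Resonator) (m p : ℕ) :
    ρ.coeff χ m * ρ.coeff χ (m * p) =
      (χ (p : ZMod q)).re * (if m.Coprime q then 1 else 0) * (ρ.G q m * ρ.G q (m * p)) := by
  have hre : (χ ((m * p : ℕ) : ZMod q)).re = (χ (m : ZMod q)).re * (χ (p : ZMod q)).re := by
    rw [Nat.cast_mul, map_mul, Complex.mul_re, im_quadratic hχ, zero_mul, sub_zero]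
  rw [← re_sq_quadratic hχ m, Resonator.coeff, Resonator.coeff, hre]
  ring

/-- **The inner sum at `k = p`** (§5, TeX l.664–668): `Σ_{m ≤ N/p} Λ(p) g_h(p) r(m) r(pm)/(pm)
= sin(πc log p/log T) χ(p)/p · Σ_{m ≤ N/p, (m,q)=1} G(m)G(pm)/m`.
[cite: BondarenkoHeap2026, §5 p. 13 (proof of Proposition 5, (17))] -/
theorem innerSum_prime (c : ℝ) (ρ : Resonator) {q : ℕ} {χ : DirichletCharacter ℂ q}
    (hχ : χ.IsQuadratic) {p : ℕ} (hp : p.Prime) (N : ℕ) (T : ℝ) :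
    ∑ m ∈ Icc 1 (N / p), ArithmeticFunction.vonMangoldt p * gWeight (gapWidth c T) p *
        ρ.coeff χ m * ρ.coeff χ (m * p) / ((p : ℝ) * m) =
      Real.sin (π * c * Real.log p / Real.log T) * (χ (p : ZMod q)).re / p *
        ∑ m ∈ (Icc 1 (N / p)).filter (fun m => Nat.Coprime m q), ρ.G q m * ρ.G q (p * m) / m := by
  rw [sum_filter, mul_sum]
  refine sum_congr rfl fun m hm => ?_
  have hm0 : (m : ℝ) ≠ 0 := by exact_mod_cast (show m ≠ 0 by have := (mem_Icc.mp hm).1; omega)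
  have hp0 : (p : ℝ) ≠ 0 := by exact_mod_cast hp.ne_zero
  rw [mul_assoc (ArithmeticFunction.vonMangoldt p * gWeight (gapWidth c T) p), coeff_mul_coeff_mul hχ,
    vonMangoldt_mul_gWeight_prime c T hp, mul_comm m p]
  split_ifs with h
  · field_simp
  · simp

/-! ### Bounds for the pieces -/

/-- `|Λ(k) g_h(k)| ≤ Λ(k) · πc/log T` (`|sin x| ≤ |x|`; `c > 0`, `T > 1`).
[cite: BondarenkoHeap2026, §5 p. 13 ("using |sin x| ⩽ |x|")] -/
theorem abs_vonMangoldt_mul_gWeight_le {c T : ℝ} (hc : 0 < c) (hT : 1 < T) (k : ℕ) :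
    |ArithmeticFunction.vonMangoldt k * gWeight (gapWidth c T) k| ≤
      ArithmeticFunction.vonMangoldt k * (π * c / Real.log T) := by
  have hlogT : 0 < Real.log T := Real.log_pos hT
  rcases Nat.lt_or_ge k 2 with hk | hk
  · interval_cases k
    · simp
    · simp [ArithmeticFunction.vonMangoldt_apply_one]
  · have hlogk : 0 < Real.log k := Real.log_pos (by exact_mod_cast hk)
    rw [abs_mul, abs_of_nonneg ArithmeticFunction.vonMangoldt_nonneg]
    refine mul_le_mul_of_nonneg_left ?_ ArithmeticFunction.vonMangoldt_nonneg
    rw [gWeight, abs_div, abs_of_pos hlogk, div_le_iff₀ hlogk, gapWidth]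
    calc |Real.sin (2 * π * c / Real.log T * Real.log k / 2)|
        ≤ |2 * π * c / Real.log T * Real.log k / 2| := Real.abs_sin_le_abs
      _ = π * c / Real.log T * Real.log k := by
          rw [abs_of_nonneg (by positivity)]; ring

/-- `|sin(πc log p/log T)| ≤ πc log p/log T` (`p ≥ 1`, `c > 0`, `T > 1`).
[cite: BondarenkoHeap2026, §5 p. 13 ("using |sin x| ⩽ |x|")] -/
theorem abs_sin_logScale_le {c T : ℝ} (hc : 0 < c) (hT : 1 < T) {p : ℕ} (hp : 1 ≤ p) :
    |Real.sin (π * c * Real.log p / Real.log T)| ≤ π * c * Real.log p / Real.log T := by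
  have hlogT : 0 < Real.log T := Real.log_pos hT
  have hlogp : 0 ≤ Real.log p := Real.log_nonneg (by exact_mod_cast hp)
  calc |Real.sin (π * c * Real.log p / Real.log T)| ≤ |π * c * Real.log p / Real.log T| :=
        Real.abs_sin_le_abs
    _ = π * c * Real.log p / Real.log T := abs_of_nonneg (by positivity)

/-- `G` is uniformly bounded: `|G(n)| ≤ M = sup_{[0,1]} |G₀|` for `q ≥ 1` and all `n`.
[cite: BondarenkoHeap2026, §2.3 p. 8 (G(n))] -/
theorem exists_G_bound (ρ : Resonator) : ∃ M : ℝ, 0 ≤ M ∧ ∀ q n : ℕ, 1 ≤ q → |ρ.G q n| ≤ M := by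
  obtain ⟨M, hM⟩ := isCompact_Icc.exists_bound_of_continuousOn
    (ρ.G₀.continuous.continuousOn (s := Set.Icc (0 : ℝ) 1))
  refine ⟨max M 0, le_max_right _ _, fun q n hq ↦ ?_⟩
  have hq1 : (1 : ℝ) ≤ q := by exact_mod_cast hq
  have hL1 : 1 ≤ lengthL q := Real.one_le_rpow hq1 (by norm_num)
  have hL0 : 0 < lengthL q := by linarith
  rw [Resonator.G, abs_mul]
  by_cases hnL : (n : ℝ) < lengthL q
  · have hlogn : 0 ≤ Real.log n := Real.log_natCast_nonneg n
    have hlogle : Real.log n ≤ Real.log (lengthL q) := by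
      rcases Nat.eq_zero_or_pos n with hn | hn
      · subst hn; simp [Real.log_nonneg hL1]
      · exact Real.log_le_log (by exact_mod_cast hn) hnL.le
    have hx : Real.log n / Real.log (lengthL q) ∈ Set.Icc (0 : ℝ) 1 := by
      rcases eq_or_lt_of_le (Real.log_nonneg hL1) with h0 | hpos
      · rw [← h0, div_zero]; exact ⟨le_rfl, zero_le_one⟩
      · exact ⟨div_nonneg hlogn hpos.le, div_le_one_of_le₀ hlogle hpos.le⟩
    have hG := hM _ hx
    rw [Real.norm_eq_abs] at hG
    have hMnn : 0 ≤ M := (abs_nonneg _).trans hG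
    have hf := Glue.abs_f₀_le_one ρ (div_nonneg (Nat.cast_nonneg n) hL0.le : (0 : ℝ) ≤ n / lengthL q)
    calc |ρ.G₀.eval (Real.log n / Real.log (lengthL q))| * |ρ.f₀ (n / lengthL q)|
        ≤ M * 1 := mul_le_mul hG hf (abs_nonneg _) hMnn
      _ ≤ max M 0 := by rw [mul_one]; exact le_max_left _ _
  · rw [ρ.f₀_eq_zero _ ((one_le_div hL0).mpr (not_lt.mp hnL)), abs_zero, mul_zero]
    exact le_max_right _ _

/-- `Σ_{m=1}^{N} 1/m ≤ 1 + log N'` for `N ≤ N'`, `1 ≤ N'` (harmonic bound). [folklore] -/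
private theorem sum_Icc_one_div_le_log {N : ℕ} {x : ℝ} (hx : 1 ≤ x) (hN : (N : ℝ) ≤ x) :
    ∑ m ∈ Icc 1 N, (1 : ℝ) / m ≤ 1 + Real.log x := by
  have h := harmonic_le_one_add_log N
  rw [harmonic_eq_sum_Icc] at h
  push_cast at h
  simp only [one_div]
  refine h.trans ?_
  rcases Nat.eq_zero_or_pos N with hn | hn
  · subst hn; simp [Real.log_nonneg hx]
  · have : Real.log N ≤ Real.log x := Real.log_le_log (by exact_mod_cast hn) hN
    linarith

/-- `|r(n)| ≤ M` whenever `|G(n)| ≤ M` (`|χ| ≤ 1`). [cite: BondarenkoHeap2026, §2.3 p. 8 (G(n))] -/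
theorem abs_coeff_le_of_G {ρ : Resonator} {q : ℕ} (χ : DirichletCharacter ℂ q) {n : ℕ} {M : ℝ}
    (hM : |ρ.G q n| ≤ M) : |ρ.coeff χ n| ≤ M := by
  rw [Resonator.coeff, abs_mul]
  have hχ : |(χ (n : ZMod q)).re| ≤ 1 := (Complex.abs_re_le_norm _).trans (χ.norm_le_one _)
  calc |(χ (n : ZMod q)).re| * |ρ.G q n| ≤ 1 * M := mul_le_mul hχ hM (abs_nonneg _) zero_le_one
    _ = M := one_mul M

/-- **"The contribution from prime powers is negligible"** (§5, TeX l.664): the terms with `k` not a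
prime are `≪ (πc/log T) M² (1 + log x) · Σ_{k not prime} Λ(k)/k ≤ 7 (πc/log T) M² (1 + log x)`
(`N ≤ x`; tree `RudnickSarnakN.sum_vonMangoldt_div_self_not_prime_le`).
[cite: BondarenkoHeap2026, §5 p. 13 (proof of Proposition 5, prime powers)] -/
theorem nonprime_part_le {c T x M : ℝ} (hc : 0 < c) (hT : 1 < T) (hx : 1 ≤ x) (ρ : Resonator)
    {q : ℕ} (χ : DirichletCharacter ℂ q) (hM0 : 0 ≤ M) (hM : ∀ n, |ρ.G q n| ≤ M) {N : ℕ}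
    (hN : (N : ℝ) ≤ x) :
    |∑ k ∈ (Icc 1 N).filter (fun k => ¬ k.Prime), ∑ m ∈ Icc 1 (N / k),
        ArithmeticFunction.vonMangoldt k * gWeight (gapWidth c T) k * ρ.coeff χ m *
          ρ.coeff χ (m * k) / ((k : ℝ) * m)|
      ≤ 7 * (π * c / Real.log T) * M ^ 2 * (1 + Real.log x) := by
  have hlogT : 0 < Real.log T := Real.log_pos hT
  have hlx : 0 ≤ 1 + Real.log x := by have := Real.log_nonneg hx; linarith
  have hterm : ∀ k ∈ (Icc 1 N).filter (fun k => ¬ k.Prime), ∀ m ∈ Icc 1 (N / k),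
      |ArithmeticFunction.vonMangoldt k * gWeight (gapWidth c T) k * ρ.coeff χ m *
          ρ.coeff χ (m * k) / ((k : ℝ) * m)| ≤
        ArithmeticFunction.vonMangoldt k * (π * c / Real.log T) * M ^ 2 / k * (1 / m) := by
    intro k hk m hm
    have hk1 : 1 ≤ k := (mem_Icc.mp (mem_filter.mp hk).1).1
    have hm1 : 1 ≤ m := (mem_Icc.mp hm).1
    have hk0 : (0 : ℝ) < k := by exact_mod_cast hk1
    have hm0 : (0 : ℝ) < m := by exact_mod_cast hm1
    rw [abs_div, abs_mul, abs_mul, abs_of_pos (mul_pos hk0 hm0)]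
    have h1 := abs_vonMangoldt_mul_gWeight_le hc hT k
    have h2 := abs_coeff_le_of_G χ (hM m)
    have h3 := abs_coeff_le_of_G χ (hM (m * k))
    have hΛ : 0 ≤ ArithmeticFunction.vonMangoldt k * (π * c / Real.log T) :=
      mul_nonneg ArithmeticFunction.vonMangoldt_nonneg (by positivity)
    have h12 : |ArithmeticFunction.vonMangoldt k * gWeight (gapWidth c T) k| * |ρ.coeff χ m| ≤
        ArithmeticFunction.vonMangoldt k * (π * c / Real.log T) * M :=
      mul_le_mul h1 h2 (abs_nonneg _) hΛ
    have h123 : |ArithmeticFunction.vonMangoldt k * gWeight (gapWidth c T) k| * |ρ.coeff χ m| *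
        |ρ.coeff χ (m * k)| ≤ ArithmeticFunction.vonMangoldt k * (π * c / Real.log T) * M * M :=
      mul_le_mul h12 h3 (abs_nonneg _) (mul_nonneg hΛ hM0)
    rw [div_le_iff₀ (mul_pos hk0 hm0)]
    calc _ ≤ ArithmeticFunction.vonMangoldt k * (π * c / Real.log T) * M * M := h123
      _ = ArithmeticFunction.vonMangoldt k * (π * c / Real.log T) * M ^ 2 / k * (1 / m) *
            ((k : ℝ) * m) := by field_simp
  have hinner : ∀ k ∈ (Icc 1 N).filter (fun k => ¬ k.Prime),
      |∑ m ∈ Icc 1 (N / k), ArithmeticFunction.vonMangoldt k * gWeight (gapWidth c T) k *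
          ρ.coeff χ m * ρ.coeff χ (m * k) / ((k : ℝ) * m)| ≤
        ArithmeticFunction.vonMangoldt k / k * ((π * c / Real.log T) * M ^ 2 * (1 + Real.log x)) := by
    intro k hk
    have hk1 : 1 ≤ k := (mem_Icc.mp (mem_filter.mp hk).1).1
    have hk0 : (0 : ℝ) < k := by exact_mod_cast hk1
    have hNk : ((N / k : ℕ) : ℝ) ≤ x := le_trans (by exact_mod_cast Nat.div_le_self N k) hN
    calc _ ≤ ∑ m ∈ Icc 1 (N / k), |ArithmeticFunction.vonMangoldt k * gWeight (gapWidth c T) k *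
            ρ.coeff χ m * ρ.coeff χ (m * k) / ((k : ℝ) * m)| := abs_sum_le_sum_abs _ _
      _ ≤ ∑ m ∈ Icc 1 (N / k),
            ArithmeticFunction.vonMangoldt k * (π * c / Real.log T) * M ^ 2 / k * (1 / m) :=
          sum_le_sum (hterm k hk)
      _ = ArithmeticFunction.vonMangoldt k * (π * c / Real.log T) * M ^ 2 / k *
            ∑ m ∈ Icc 1 (N / k), (1 / (m : ℝ)) := by rw [mul_sum]
      _ ≤ ArithmeticFunction.vonMangoldt k * (π * c / Real.log T) * M ^ 2 / k *
            (1 + Real.log x) := by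
          refine mul_le_mul_of_nonneg_left (sum_Icc_one_div_le_log hx hNk) ?_
          exact div_nonneg (mul_nonneg (mul_nonneg ArithmeticFunction.vonMangoldt_nonneg
            (by positivity)) (sq_nonneg _)) hk0.le
      _ = _ := by ring
  have h7 := RudnickSarnakN.sum_vonMangoldt_div_self_not_prime_le N
  calc _ ≤ ∑ k ∈ (Icc 1 N).filter (fun k => ¬ k.Prime), |∑ m ∈ Icc 1 (N / k),
          ArithmeticFunction.vonMangoldt k * gWeight (gapWidth c T) k * ρ.coeff χ m *
            ρ.coeff χ (m * k) / ((k : ℝ) * m)| := abs_sum_le_sum_abs _ _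
    _ ≤ ∑ k ∈ (Icc 1 N).filter (fun k => ¬ k.Prime),
          ArithmeticFunction.vonMangoldt k / k * ((π * c / Real.log T) * M ^ 2 * (1 + Real.log x)) :=
        sum_le_sum hinner
    _ = (∑ k ∈ (Icc 1 N).filter (fun k => ¬ k.Prime), ArithmeticFunction.vonMangoldt k / k) *
          ((π * c / Real.log T) * M ^ 2 * (1 + Real.log x)) := by rw [sum_mul]
    _ ≤ 7 * ((π * c / Real.log T) * M ^ 2 * (1 + Real.log x)) := by
        refine mul_le_mul_of_nonneg_right h7 (by positivity)
    _ = _ := by ring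

/-- **Primes dividing `q`**: for `S ⊆ {p | q}` and `q ≥ 3`, `Σ_{p ∈ S} log p/p ≤ log log q + log 4 + 1`
(split at `y = log q`: Mertens for `p ≤ y`, and `Σ_{p | q, p > y} log p/p ≤ (1/y) Σ_{p|q} log p ≤ (log q)/y`).
[folklore] -/
private theorem sum_log_div_le_of_subset_primeFactors {q : ℕ} (hq : 3 ≤ q) {S : Finset ℕ}
    (hS : S ⊆ q.primeFactors) :
    ∑ p ∈ S, Real.log p / p ≤ Real.log (Real.log q) + Real.log 4 + 1 := by
  have hq0 : (0 : ℝ) < q := by exact_mod_cast (show 0 < q by omega)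
  have hq3 : (3 : ℝ) ≤ q := by exact_mod_cast hq
  set y : ℝ := Real.log q with hy
  have hy1 : 1 < y := by
    rw [hy]
    have : Real.log 3 ≤ Real.log q := Real.log_le_log (by norm_num) hq3
    linarith [MertensBound.one_lt_log_three]
  have hy0 : 0 < y := by linarith
  classical
  rw [← sum_filter_add_sum_filter_not S (fun p => p ≤ ⌊y⌋₊)]
  -- small primes: Mertens
  have hsmall : ∑ p ∈ S.filter (fun p => p ≤ ⌊y⌋₊), Real.log p / p ≤ Real.log y + Real.log 4 := by
    have hsub : S.filter (fun p => p ≤ ⌊y⌋₊) ⊆ Nat.primesLE ⌊y⌋₊ := by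
      intro p hp
      rw [mem_filter] at hp
      exact Nat.mem_primesLE.mpr ⟨hp.2, Nat.prime_of_mem_primeFactors (hS hp.1)⟩
    have hfl1 : 1 ≤ ⌊y⌋₊ := Nat.one_le_floor_iff _ |>.mpr hy1.le
    have hfl0 : (0 : ℝ) < ⌊y⌋₊ := by exact_mod_cast hfl1
    calc ∑ p ∈ S.filter (fun p => p ≤ ⌊y⌋₊), Real.log p / p
        ≤ ∑ p ∈ Nat.primesLE ⌊y⌋₊, Real.log p / p := by
          refine sum_le_sum_of_subset_of_nonneg hsub fun p hp _ => ?_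
          have := (Nat.mem_primesLE.mp hp).2.one_lt
          exact div_nonneg (Real.log_nonneg (by exact_mod_cast this.le)) (Nat.cast_nonneg _)
      _ ≤ Real.log ⌊y⌋₊ + Real.log 4 := MertensBound.sum_log_div_prime_le _
      _ ≤ Real.log y + Real.log 4 := by
          have := Real.log_le_log hfl0 (Nat.floor_le hy0.le)
          linarith
  -- large primes: `Σ_{p | q, p > y} log p / p ≤ (Σ_{p | q} log p)/y ≤ log q / y = 1`
  have hlarge : ∑ p ∈ S.filter (fun p => ¬ p ≤ ⌊y⌋₊), Real.log p / p ≤ 1 := by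
    have hstep : ∀ p ∈ S.filter (fun p => ¬ p ≤ ⌊y⌋₊), Real.log p / p ≤ Real.log p / y := by
      intro p hp
      rw [mem_filter, not_le] at hp
      have hpy : y ≤ p := (Nat.lt_of_floor_lt hp.2).le
      have hp1 := (Nat.prime_of_mem_primeFactors (hS hp.1)).one_lt
      exact div_le_div_of_nonneg_left (Real.log_nonneg (by exact_mod_cast hp1.le)) hy0 hpy
    have hsumlog : ∑ p ∈ S.filter (fun p => ¬ p ≤ ⌊y⌋₊), Real.log p ≤ y := by
      have hsub : S.filter (fun p => ¬ p ≤ ⌊y⌋₊) ⊆ q.primeFactors :=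
        (filter_subset _ _).trans hS
      calc ∑ p ∈ S.filter (fun p => ¬ p ≤ ⌊y⌋₊), Real.log p
          ≤ ∑ p ∈ q.primeFactors, Real.log p := by
            refine sum_le_sum_of_subset_of_nonneg hsub fun p hp _ => ?_
            exact Real.log_nonneg (by exact_mod_cast (Nat.prime_of_mem_primeFactors hp).one_lt.le)
        _ = Real.log (∏ p ∈ q.primeFactors, (p : ℝ)) := by
            rw [Real.log_prod]
            intro p hp
            exact_mod_cast (Nat.prime_of_mem_primeFactors hp).ne_zero
        _ ≤ y := by
            rw [hy]
            have hdvd := Nat.prod_primeFactors_dvd q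
            have hle : ((∏ p ∈ q.primeFactors, p : ℕ) : ℝ) ≤ q := by
              exact_mod_cast Nat.le_of_dvd (by omega) hdvd
            have hpos : (0 : ℝ) < ((∏ p ∈ q.primeFactors, p : ℕ) : ℝ) := by
              have : 0 < ∏ p ∈ q.primeFactors, p :=
                prod_pos fun p hp => (Nat.prime_of_mem_primeFactors hp).pos
              exact_mod_cast this
            push_cast at hle hpos
            exact Real.log_le_log hpos hle
    calc ∑ p ∈ S.filter (fun p => ¬ p ≤ ⌊y⌋₊), Real.log p / p
        ≤ ∑ p ∈ S.filter (fun p => ¬ p ≤ ⌊y⌋₊), Real.log p / y := sum_le_sum hstep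
      _ = (∑ p ∈ S.filter (fun p => ¬ p ≤ ⌊y⌋₊), Real.log p) / y := by rw [sum_div]
      _ ≤ y / y := div_le_div_of_nonneg_right hsumlog hy0.le
      _ = 1 := div_self hy0.ne'
  have hlogy : Real.log y = Real.log (Real.log q) := by rw [hy]
  linarith

/-- `(log log q)^n ≤ ε log q` for `q ≥ q₀(n, ε)`. [folklore] -/
private theorem exists_loglog_pow_le (n : ℕ) {ε : ℝ} (hε : 0 < ε) :
    ∃ q₀ : ℕ, ∀ q : ℕ, q₀ ≤ q → Real.log (Real.log q) ^ n ≤ ε * Real.log q := by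
  have h := (Real.isLittleO_pow_log_id_atTop (n := n)).bound hε
  have h2 := (Real.tendsto_log_atTop.comp tendsto_natCast_atTop_atTop).eventually h
  obtain ⟨q₀, hq₀⟩ := Filter.eventually_atTop.mp h2
  refine ⟨max q₀ 1, fun q hq => ?_⟩
  have hq1 : 1 ≤ q := le_trans (le_max_right _ _) hq
  have hb := hq₀ q (le_trans (le_max_left _ _) hq)
  simp only [Function.comp_apply, id_eq, Real.norm_eq_abs] at hb
  have hlog0 : 0 ≤ Real.log q := Real.log_nonneg (by exact_mod_cast hq1)
  rw [abs_of_nonneg hlog0] at hb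
  exact (le_abs_self _).trans hb

/-- The primes of `[1, N]`. [folklore] -/
private theorem filter_prime_Icc_eq_primesLE (N : ℕ) : (Icc 1 N).filter Nat.Prime = Nat.primesLE N := by
  ext p
  simp only [mem_filter, mem_Icc, Nat.mem_primesLE]
  constructor
  · rintro ⟨⟨_, h2⟩, hp⟩; exact ⟨h2, hp⟩
  · rintro ⟨h2, hp⟩; exact ⟨⟨hp.one_lt.le, h2⟩, hp⟩

/-- The primes of `[0, N]` are those of `[1, N]`. [folklore] -/
private theorem filter_prime_Iic_eq (N : ℕ) : (Iic N).filter Nat.Prime = (Icc 1 N).filter Nat.Prime := by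
  ext p
  simp only [mem_filter, mem_Iic, mem_Icc]
  constructor
  · rintro ⟨h2, hp⟩; exact ⟨⟨hp.one_lt.le, h2⟩, hp⟩
  · rintro ⟨⟨_, h2⟩, hp⟩; exact ⟨h2, hp⟩

/-- `Σ_{p ≤ N} |sin(πc log p/log T)|/p ≤ (πc/log T)(log N + log 4)` (`|sin x| ≤ |x|` and Mertens).
[cite: BondarenkoHeap2026, §5 p. 13 ("using |sin x| ⩽ |x| to bound the outer sum over primes")] -/
theorem sum_abs_sin_div_le {c T : ℝ} (hc : 0 < c) (hT : 1 < T) (N : ℕ) :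
    ∑ p ∈ (Icc 1 N).filter Nat.Prime, |Real.sin (π * c * Real.log p / Real.log T)| / p ≤
      π * c / Real.log T * (Real.log N + Real.log 4) := by
  have hlogT : 0 < Real.log T := Real.log_pos hT
  rw [filter_prime_Icc_eq_primesLE]
  calc ∑ p ∈ Nat.primesLE N, |Real.sin (π * c * Real.log p / Real.log T)| / p
      ≤ ∑ p ∈ Nat.primesLE N, π * c / Real.log T * (Real.log p / p) := by
        refine sum_le_sum fun p hp => ?_
        have hp1 := (Nat.mem_primesLE.mp hp).2.one_lt
        have hp0 : (0 : ℝ) < p := by exact_mod_cast (by omega : 0 < p)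
        rw [div_le_iff₀ hp0]
        calc |Real.sin (π * c * Real.log p / Real.log T)| ≤ π * c * Real.log p / Real.log T :=
              abs_sin_logScale_le hc hT hp1.le
          _ = π * c / Real.log T * (Real.log p / p) * p := by field_simp
    _ = π * c / Real.log T * ∑ p ∈ Nat.primesLE N, Real.log p / p := by rw [mul_sum]
    _ ≤ π * c / Real.log T * (Real.log N + Real.log 4) :=
        mul_le_mul_of_nonneg_left (MertensBound.sum_log_div_prime_le N) (by positivity)

/-- For a quadratic character and a prime `p`: `χ(p) + 1 ≤ 1_{p ∣ q} + 2·1_{χ(p) = 1}` (real parts).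
[cite: BondarenkoHeap2026, §5 p. 13 ("It then remains to justify replacing χ(p) by −1")] -/
theorem re_add_one_le {q : ℕ} {χ : DirichletCharacter ℂ q} (hχ : χ.IsQuadratic) {p : ℕ}
    (hp : p.Prime) :
    (χ (p : ZMod q)).re + 1 ≤
      (if p ∣ q then 1 else 0) + 2 * (if χ (p : ZMod q) = 1 then 1 else 0) := by
  by_cases hpq : p ∣ q
  · have hnc : ¬ p.Coprime q := by
      rw [Nat.Prime.coprime_iff_not_dvd hp]; exact not_not.mpr hpq
    have h0 : χ (p : ZMod q) = 0 := χ.map_nonunit (mt (ZMod.isUnit_iff_coprime p q).mp hnc)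
    rw [if_pos hpq, h0]; simp
  · rw [if_neg hpq]
    rcases hχ (p : ZMod q) with h | h | h
    · have hc : p.Coprime q := (Nat.Prime.coprime_iff_not_dvd hp).mpr hpq
      exact absurd h (((ZMod.isUnit_iff_coprime p q).mpr hc).map χ).ne_zero
    · rw [h]; norm_num
    · rw [h]; norm_num

/-- **The bad primes `χ(p) ≠ −1`** (§5, TeX l.672–690): with `x_p = χ(p)`,
`Σ_{p ≤ N} (x_p + 1)|sin(πc log p/log T)|/p ≤ (πc/log T)·[(log log q + log 4 + 1) + 2 Σ_{p ≤ q^500, χ(p)=1} log p/p]`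
(`N ≤ q^500`; the primes `p ∣ q` by `sum_log_div_le_of_subset_primeFactors`, the primes with `χ(p) = 1`
are mimicry primes). [cite: BondarenkoHeap2026, §5 p. 13 (proof of Proposition 5, last two displays)] -/
theorem badPrimes_le {c T : ℝ} (hc : 0 < c) (hT : 1 < T) {q : ℕ} (hq : 3 ≤ q)
    {χ : DirichletCharacter ℂ q} (hχ : χ.IsQuadratic) {N : ℕ} (hN : N ≤ q ^ 500) :
    ∑ p ∈ (Icc 1 N).filter Nat.Prime,
        ((χ (p : ZMod q)).re + 1) * |Real.sin (π * c * Real.log p / Real.log T)| / p ≤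
      π * c / Real.log T * ((Real.log (Real.log q) + Real.log 4 + 1) +
        2 * ∑ p ∈ mimicryPrimes χ, Real.log p / p) := by
  have hlogT : 0 < Real.log T := Real.log_pos hT
  set P := (Icc 1 N).filter Nat.Prime with hP
  have hterm : ∀ p ∈ P, ((χ (p : ZMod q)).re + 1) * |Real.sin (π * c * Real.log p / Real.log T)| / p ≤
      π * c / Real.log T * ((if p ∣ q then Real.log p / p else 0) +
        2 * (if χ (p : ZMod q) = 1 then Real.log p / p else 0)) := by
    intro p hp
    have hpp : p.Prime := (mem_filter.mp hp).2
    have hp0 : (0 : ℝ) < p := by exact_mod_cast hpp.pos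
    have hlogp : 0 ≤ Real.log p := Real.log_nonneg (by exact_mod_cast hpp.one_lt.le)
    have hs := abs_sin_logScale_le hc hT hpp.one_lt.le
    have hx := re_add_one_le hχ hpp
    have hx0 : 0 ≤ (χ (p : ZMod q)).re + 1 := by
      have := (abs_le.mp ((Complex.abs_re_le_norm _).trans (χ.norm_le_one (p : ZMod q)))).1
      linarith
    rw [div_le_iff₀ hp0]
    calc ((χ (p : ZMod q)).re + 1) * |Real.sin (π * c * Real.log p / Real.log T)|
        ≤ ((if p ∣ q then 1 else 0) + 2 * (if χ (p : ZMod q) = 1 then 1 else 0)) *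
            (π * c * Real.log p / Real.log T) :=
          mul_le_mul hx hs (abs_nonneg _) (by positivity)
      _ = π * c / Real.log T * ((if p ∣ q then Real.log p / p else 0) +
            2 * (if χ (p : ZMod q) = 1 then Real.log p / p else 0)) * p := by
          split_ifs <;> field_simp <;> ring
  refine (sum_le_sum hterm).trans ?_
  rw [← mul_sum, sum_add_distrib, ← mul_sum, ← sum_filter, ← sum_filter]
  refine mul_le_mul_of_nonneg_left (add_le_add ?_ ?_) (by positivity)
  · -- primes dividing q
    refine sum_log_div_le_of_subset_primeFactors hq fun p hp => ?_
    rw [mem_filter] at hp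
    exact Nat.mem_primeFactors.mpr ⟨(mem_filter.mp hp.1).2, hp.2, by omega⟩
  · -- mimicry primes
    refine mul_le_mul_of_nonneg_left ?_ (by norm_num)
    refine sum_le_sum_of_subset_of_nonneg (fun p hp => ?_) fun p hp _ => ?_
    · rw [mem_filter] at hp
      have hpP := mem_filter.mp hp.1
      exact mem_mimicryPrimes.mpr ⟨le_trans (mem_Icc.mp hpP.1).2 hN, hpP.2, hp.2⟩
    · have hpp := (mem_mimicryPrimes.mp hp).2.1
      exact div_nonneg (Real.log_nonneg (by exact_mod_cast hpp.one_lt.le)) (Nat.cast_nonneg _)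

/-! ### Proposition 5 from (17), Proposition 3, (18) and (3) -/

/-- `K · (e/K · y) = e · y` for `K ≠ 0`. [folklore] -/
private theorem mul_div_mul_cancel_aux {K e y : ℝ} (hK : K ≠ 0) : K * (e / K * y) = e * y := by
  rw [div_mul_eq_mul_div, mul_div_assoc', mul_div_cancel_left₀ _ hK]

/-- `Ŵ_T(0) ≥ C_Φ T/2` for `q` large, from (3): `|Ŵ_T(0) − C_Φ T| ≤ K/T` and `C_Φ > 0`.
[cite: BondarenkoHeap2026, §2.1 (3) p. 5] -/
theorem weightHat_zero_lower (hC : cPhi_pos) (hW : weightHat_zero) (w : Bump) (B : ℕ)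
    (ρ : Resonator) :
    ∃ q₁ : ℕ, ∀ q : ℕ, q₁ ≤ q → cPhi w B * ρ.T q / 2 ≤ weightHat w B (ρ.T q) 0 := by
  obtain ⟨K, hK⟩ := hW w B
  have hCΦ : 0 < cPhi w B := hC w B
  refine ⟨max 2 ⌈2 * K / cPhi w B⌉₊, fun q hq => ?_⟩
  have hq2 : 2 ≤ q := le_trans (le_max_left _ _) hq
  have hqK : (⌈2 * K / cPhi w B⌉₊ : ℝ) ≤ q := by exact_mod_cast le_trans (le_max_right _ _) hq
  have hq1r : (1 : ℝ) ≤ q := by exact_mod_cast (by omega : 1 ≤ q)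
  set T := ρ.T q with hT
  have hTq : (q : ℝ) ≤ T := le_T ρ (by omega)
  have hT1 : 1 ≤ T := hq1r.trans hTq
  have hT0 : 0 < T := by linarith
  have hKT : K ≤ cPhi w B * T ^ 2 / 2 := by
    have h1 : 2 * K / cPhi w B ≤ q := (Nat.le_ceil _).trans hqK
    have h2 : (q : ℝ) ≤ T ^ 2 := hTq.trans (by nlinarith)
    have h3 : 2 * K / cPhi w B ≤ T ^ 2 := h1.trans h2
    rw [div_le_iff₀ hCΦ] at h3
    linarith
  have h := hK T hT1
  have h' : cPhi w B * T - K * T⁻¹ ≤ weightHat w B T 0 := by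
    linarith [(abs_le.mp h).1]
  have hKT' : K * T⁻¹ ≤ cPhi w B * T / 2 := by
    rw [← div_eq_mul_inv, div_le_iff₀ hT0]
    nlinarith
  linarith

/-- **Proposition 5 from (17), Proposition 3, (18), and (3)** — the printed proof of Proposition 5
(§5, TeX l.655–700) with its inputs as hypotheses: "Taking `km = n`" (`diagD_eq_sum`), "the
contribution from prime powers is negligible" (`nonprime_part_le`), the inner `m`-sum by (17), the
`p`-sum main term by (18) ("the prime number theorem and partial summation"), "the accumulated error
from (17) is `O(T (log log q)²)` … negligible compared with `T(φ(q)/q) log L`" (here via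
`φ(q)/q ≫ 1/log log q`), and "it then remains to justify replacing `χ(p)` by `−1`" by Proposition 3
(`badPrimes_le`), `L = q^{17/6} < q^{500}`; `Ŵ_T(0) ≍ T` is (3) (`weightHat_zero`, `cPhi_pos`). The
bound on `C_G` is passed as the hypothesis `hcG` (it is `cG_bound_lipschitz` of the proofs file).
[cite: BondarenkoHeap2026, Proposition 5 (proof, §5 pp. 13–14)] -/
theorem prop5_of_eq17_prop3_aux (h17 : eq17) (h3 : prop3) (h18 : eq18) (hC : cPhi_pos)
    (hW : weightHat_zero)
    (hcG : ∀ G₀ : Polynomial ℝ, ∃ K : ℝ, 0 ≤ K ∧ ∀ u ∈ Set.Icc (0 : ℝ) 1, |cG G₀ u| ≤ K) :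
    prop5 := by
  intro c hc w B ρ
  obtain ⟨M, hM0, hM⟩ := exists_G_bound ρ
  obtain ⟨KG, hKG0, hKG⟩ := hcG ρ.G₀
  obtain ⟨K17, q17, h17'⟩ := h17 ρ
  obtain ⟨C3, hC30, h3'⟩ := prop3_of_isSiegelZero h3
  obtain ⟨δφ, hδφ0, hδφ⟩ := MertensBound.exists_lt_totient_div_self
  obtain ⟨qW, hqW'⟩ := weightHat_zero_lower hC hW w B ρ
  have hCΦ : 0 < cPhi w B := hC w B
  set K₁ := max K17 0 with hK₁
  have hK₁0 : 0 ≤ K₁ := le_max_right _ _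
  refine ⟨π * c * KG * C3, by positivity, fun η hη => ?_⟩
  set η' := η / 4 with hη'
  have hη'0 : 0 < η' := by positivity
  obtain ⟨q18, h18'⟩ := h18 ρ c hc η' hη'0
  obtain ⟨qA, hqA⟩ := exists_loglog_pow_le 3 (ε := 2 * η' * δφ / (3 * π * c * K₁ + 1)) (by positivity)
  obtain ⟨qB, hqB⟩ :=
    exists_loglog_pow_le 1 (ε := 2 * η' * δφ / (21 * π * c * M ^ 2 + 1)) (by positivity)
  obtain ⟨qC, hqC⟩ := exists_loglog_pow_le 1 (ε := η' / (KG * π * c + 1)) (by positivity)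
  obtain ⟨qD, hqD⟩ := exists_loglog_pow_le 0 (ε := η' / (3 * (KG * π * c + 1))) (by positivity)
  refine ⟨3 + qW + q17 + q18 + qA + qB + qC + qD, fun q _ χ E hq hSZ => ?_⟩
  have hq3 : 3 ≤ q := by omega
  have hWlow := hqW' q (by omega)
  have hA' := hqA q (by omega)
  have hB' := hqB q (by omega)
  have hC' := hqC q (by omega)
  have hD' := hqD q (by omega)
  have h18q := h18' q (by omega)
  have h17q := h17' q (by omega)
  clear hqA hqB hqC hqD h18' h17' hqW'
  have hχq : χ.IsQuadratic := hSZ.2.1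
  have hE10 : 10 ≤ E := hSZ.2.2.1
  have h3q := h3' q χ E hSZ
  have hlogE0 : 0 < Real.sqrt (Real.log E) :=
    Real.sqrt_pos.mpr (Real.log_pos (by linarith only [hE10]))
  -- real-number facts about q, L, T, N
  have hq0 : (0 : ℝ) < q := by exact_mod_cast (show 0 < q by omega)
  have hq1 : (1 : ℝ) < q := by exact_mod_cast (show 1 < q by omega)
  have hq3r : (3 : ℝ) ≤ q := by exact_mod_cast hq3
  have hlogq1 : 1 < Real.log q :=
    lt_of_lt_of_le MertensBound.one_lt_log_three (Real.log_le_log (by norm_num) hq3r)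
  have hlogq0 : 0 < Real.log q := lt_trans one_pos hlogq1
  have hll0 : 0 < Real.log (Real.log q) := Real.log_pos hlogq1
  set ll := Real.log (Real.log q) with hll
  set L := lengthL q with hL
  set T := ρ.T q with hT
  set N := ⌊L⌋₊ with hN
  have hlogL : Real.log L = 17 / 6 * Real.log q := by rw [hL, lengthL, Real.log_rpow hq0]
  have hL9 : 9 ≤ L := by
    have h1 : (q : ℝ) ^ (2 : ℝ) ≤ L := by
      rw [hL, lengthL]; exact Real.rpow_le_rpow_of_exponent_le hq1.le (by norm_num)
    have h2 : (9 : ℝ) ≤ (q : ℝ) ^ (2 : ℝ) := by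
      rw [Real.rpow_two]
      calc (9 : ℝ) = 3 ^ 2 := by norm_num
        _ ≤ (q : ℝ) ^ 2 := by gcongr
    exact h2.trans h1
  have hL0 : 0 < L := lt_of_lt_of_le (by norm_num) hL9
  have hL1 : 1 ≤ L := (by norm_num : (1 : ℝ) ≤ 9).trans hL9
  have hlogL1 : 1 ≤ Real.log L := by
    rw [Real.le_log_iff_exp_le hL0]
    exact (Real.exp_one_lt_d9.le.trans (by norm_num)).trans hL9
  have hlogL0 : 0 < Real.log L := lt_of_lt_of_le one_pos hlogL1
  have hlog4L : Real.log 4 ≤ Real.log L :=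
    Real.log_le_log (by norm_num) ((by norm_num : (4 : ℝ) ≤ 9).trans hL9)
  have hlog4 : Real.log 4 ≤ 2 := by
    have : Real.log 4 = 2 * Real.log 2 := by
      rw [show (4 : ℝ) = 2 ^ 2 by norm_num, Real.log_pow]; norm_num
    rw [this]
    have := Real.log_two_lt_d9
    linarith only [this]
  have hδ := ρ.δ_pos
  have hlogT : Real.log T = (7 / 3 + ρ.δ) * Real.log q := by
    rw [hT, Resonator.T, Real.log_rpow hq0]
  have hT1 : 1 < T := by
    rw [hT, Resonator.T]; exact Real.one_lt_rpow hq1 (by linarith only [hδ])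
  have hT0 : 0 < T := lt_trans one_pos hT1
  have hlogT0 : 0 < Real.log T := Real.log_pos hT1
  have hlogT2 : 2 * Real.log q ≤ Real.log T := by
    rw [hlogT]
    exact mul_le_mul_of_nonneg_right (by linarith only [hδ]) hlogq0.le
  have hLT : Real.log L ≤ 17 / 14 * Real.log T := by
    rw [hlogL, hlogT]
    have h1 : (17 / 6 : ℝ) ≤ 17 / 14 * (7 / 3 + ρ.δ) := by linarith only [hδ]
    calc 17 / 6 * Real.log q ≤ 17 / 14 * (7 / 3 + ρ.δ) * Real.log q :=
          mul_le_mul_of_nonneg_right h1 hlogq0.le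
      _ = _ := by ring
  have hNL : (N : ℝ) ≤ L := Nat.floor_le hL0.le
  have hN1 : 1 ≤ N := by rw [hN]; exact Nat.floor_pos.mpr hL1
  have hN0 : (0 : ℝ) < N := by exact_mod_cast hN1
  have hlogN : Real.log N ≤ Real.log L := Real.log_le_log hN0 hNL
  have hN500 : N ≤ q ^ 500 := by
    have h1 : L ≤ (q : ℝ) ^ (500 : ℝ) := by
      rw [hL, lengthL]; exact Real.rpow_le_rpow_of_exponent_le hq1.le (by norm_num)
    have h2 : (N : ℝ) ≤ ((q ^ 500 : ℕ) : ℝ) := by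
      rw [Nat.cast_pow, ← Real.rpow_natCast]; push_cast; exact hNL.trans h1
    exact_mod_cast h2
  -- `W = Ŵ_T(0) ≥ C_Φ T/2 > 0` by (3)
  set W := weightHat w B T 0 with hWdef
  have hW0 : 0 < W := lt_of_lt_of_le (div_pos (mul_pos hCΦ hT0) two_pos) hWlow
  -- `Φq = φ(q)/q ≫ 1/log log q`
  set Φq := (Nat.totient q : ℝ) / q with hΦq
  have hΦql : δφ / ll < Φq := hδφ q hq3
  have hΦq0 : 0 < Φq := lt_trans (div_pos hδφ0 hll0) hΦql
  have hS : scaleS w B ρ q = W * Φq * Real.log L := rfl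
  have hWΦL0 : 0 ≤ W * Φq * Real.log L := mul_nonneg (mul_nonneg hW0.le hΦq0.le) hlogL0.le
  have hkey : η' * (δφ / ll) * (2 * Real.log q) ≤ η' * Φq * Real.log L := by
    rw [hlogL]
    have h1 : δφ / ll * (2 * Real.log q) ≤ Φq * (17 / 6 * Real.log q) :=
      mul_le_mul hΦql.le (by linarith only [hlogq0]) (by linarith only [hlogq0]) hΦq0.le
    have h2 := mul_le_mul_of_nonneg_left h1 hη'0.le
    calc η' * (δφ / ll) * (2 * Real.log q) = η' * (δφ / ll * (2 * Real.log q)) := by ring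
      _ ≤ η' * (Φq * (17 / 6 * Real.log q)) := h2
      _ = _ := by ring
  -- the primes `p ≤ N` and the pieces of the decomposition
  set P := (Icc 1 N).filter Nat.Prime with hP
  have hPprime : ∀ p ∈ P, p.Prime := fun p hp => (mem_filter.mp hp).2
  have hPle : ∀ p ∈ P, (p : ℝ) ≤ L := fun p hp =>
    le_trans (by exact_mod_cast (mem_Icc.mp (mem_filter.mp hp).1).2) hNL
  set s : ℕ → ℝ := fun p => Real.sin (π * c * Real.log p / Real.log T) with hs
  set x : ℕ → ℝ := fun p => (χ (p : ZMod q)).re with hx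
  set u : ℕ → ℝ := fun p => Real.log p / Real.log L with hu
  set a : ℕ → ℝ := fun p =>
    ∑ m ∈ (Icc 1 (N / p)).filter (fun m => Nat.Coprime m q), ρ.G q m * ρ.G q (p * m) / m with ha
  set e : ℕ → ℝ := fun p => a p - cG ρ.G₀ (u p) * Φq * Real.log L with he
  set Isin := sineIntegralCG ρ.δ c ρ.G₀ with hIsin
  set S18 := ∑ p ∈ P, 1 / (p : ℝ) * cG ρ.G₀ (u p) * s p with hS18
  set Bad := ∑ p ∈ P, (x p + 1) * s p * cG ρ.G₀ (u p) / p with hBad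
  set E17 := ∑ p ∈ P, s p * x p / p * e p with hE17
  set Rpp := ∑ k ∈ (Icc 1 N).filter (fun k => ¬ k.Prime), ∑ m ∈ Icc 1 (N / k),
    ArithmeticFunction.vonMangoldt k * gWeight (gapWidth c T) k * ρ.coeff χ m *
      ρ.coeff χ (m * k) / ((k : ℝ) * m) with hRpp
  -- (17) termwise
  have he17 : ∀ p ∈ P, |e p| ≤ K₁ * ll ^ 2 := by
    intro p hp
    have h := h17q p (hPprime p hp) (hPle p hp)
    rw [Nat.floor_div_natCast] at h
    refine le_trans h ?_
    exact mul_le_mul_of_nonneg_right (le_max_left _ _) (sq_nonneg _)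
  -- (18)
  have h18P : |S18 - Isin| ≤ η' := by
    rw [filter_prime_Iic_eq] at h18q
    exact h18q
  -- the decomposition `𝒟 = W (Σ_P + Rpp)` and the evaluation of `Σ_P`
  have hD : diagD c w B ρ χ = W * ((∑ p ∈ P, ∑ m ∈ Icc 1 (N / p),
      ArithmeticFunction.vonMangoldt p * gWeight (gapWidth c T) p * ρ.coeff χ m *
        ρ.coeff χ (m * p) / ((p : ℝ) * m)) + Rpp) := by
    rw [diagD_eq_sum, ← sum_filter_add_sum_filter_not _ Nat.Prime]
  have hsumP : ∑ p ∈ P, ∑ m ∈ Icc 1 (N / p),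
      ArithmeticFunction.vonMangoldt p * gWeight (gapWidth c T) p * ρ.coeff χ m *
        ρ.coeff χ (m * p) / ((p : ℝ) * m) = Φq * Real.log L * (-S18 + Bad) + E17 := by
    have hterm : ∀ p ∈ P, ∑ m ∈ Icc 1 (N / p),
        ArithmeticFunction.vonMangoldt p * gWeight (gapWidth c T) p * ρ.coeff χ m *
          ρ.coeff χ (m * p) / ((p : ℝ) * m) =
        Φq * Real.log L * (-(1 / (p : ℝ) * cG ρ.G₀ (u p) * s p) +
          (x p + 1) * s p * cG ρ.G₀ (u p) / p) + s p * x p / p * e p := by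
      intro p hp
      rw [innerSum_prime c ρ hχq (hPprime p hp) N T]
      simp only [hs, hx, hu, ha, he]
      ring
    rw [sum_congr rfl hterm, sum_add_distrib, ← mul_sum, sum_add_distrib, sum_neg_distrib]
  have hJ : Jmain c w B ρ q = W * Φq * Real.log L * Isin := rfl
  have hfinal : diagD c w B ρ χ + Jmain c w B ρ q =
      W * Φq * Real.log L * (-(S18 - Isin)) + W * Φq * Real.log L * Bad + W * E17 + W * Rpp := by
    rw [hD, hsumP, hJ]; ring
  -- bound for E17 ("the accumulated error from (17)")
  have hE17b : |E17| ≤ 3 * π * c * K₁ * ll ^ 2 := by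
    have hK₁ll : 0 ≤ K₁ * ll ^ 2 := mul_nonneg hK₁0 (sq_nonneg _)
    calc |E17| ≤ ∑ p ∈ P, |s p * x p / p * e p| := abs_sum_le_sum_abs _ _
      _ ≤ ∑ p ∈ P, |s p| / p * (K₁ * ll ^ 2) := by
          refine sum_le_sum fun p hp => ?_
          have hp0 : (0 : ℝ) < p := by exact_mod_cast (hPprime p hp).pos
          have hx1 : |x p| ≤ 1 := by
            simp only [hx]; exact (Complex.abs_re_le_norm _).trans (χ.norm_le_one _)
          rw [abs_mul, abs_div, abs_mul, abs_of_pos hp0]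
          have h1 : |s p| * |x p| / p ≤ |s p| / p := by
            refine div_le_div_of_nonneg_right ?_ hp0.le
            calc |s p| * |x p| ≤ |s p| * 1 := mul_le_mul_of_nonneg_left hx1 (abs_nonneg _)
              _ = |s p| := mul_one _
          exact mul_le_mul h1 (he17 p hp) (abs_nonneg _) (div_nonneg (abs_nonneg _) hp0.le)
      _ = (∑ p ∈ P, |s p| / p) * (K₁ * ll ^ 2) := by rw [sum_mul]
      _ ≤ π * c / Real.log T * (Real.log N + Real.log 4) * (K₁ * ll ^ 2) :=
          mul_le_mul_of_nonneg_right (sum_abs_sin_div_le hc hT1 N) hK₁ll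
      _ = π * c * ((Real.log N + Real.log 4) / Real.log T) * (K₁ * ll ^ 2) := by ring
      _ ≤ π * c * 3 * (K₁ * ll ^ 2) := by
          have h1 : (Real.log N + Real.log 4) / Real.log T ≤ 3 := by
            rw [div_le_iff₀ hlogT0]; linarith only [hlogN, hlog4L, hLT, hlogT0]
          have h2 : π * c * ((Real.log N + Real.log 4) / Real.log T) ≤ π * c * 3 :=
            mul_le_mul_of_nonneg_left h1 (by positivity)
          exact mul_le_mul_of_nonneg_right h2 hK₁ll
      _ = 3 * π * c * K₁ * ll ^ 2 := by ring
  have hb3 : W * |E17| ≤ η' * scaleS w B ρ q := by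
    rw [hS]
    have h1 : 3 * π * c * K₁ * ll ^ 2 ≤ η' * Φq * Real.log L := by
      have h2 : (3 * π * c * K₁ + 1) * ll ^ 3 ≤ 2 * η' * δφ * Real.log q := by
        have hKp : (0 : ℝ) < 3 * π * c * K₁ + 1 := by positivity
        have := mul_le_mul_of_nonneg_left hA' hKp.le
        rwa [mul_div_mul_cancel_aux hKp.ne'] at this
      have hll3 : 0 ≤ ll ^ 3 := by positivity
      have h3 : 3 * π * c * K₁ * ll ^ 3 ≤ 2 * η' * δφ * Real.log q := by
        linarith only [h2, hll3]
      have h4 : 3 * π * c * K₁ * ll ^ 2 ≤ η' * (δφ / ll) * (2 * Real.log q) := by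
        rw [show η' * (δφ / ll) * (2 * Real.log q) = 2 * η' * δφ * Real.log q / ll by ring]
        rw [le_div_iff₀ hll0]
        calc 3 * π * c * K₁ * ll ^ 2 * ll = 3 * π * c * K₁ * ll ^ 3 := by ring
          _ ≤ _ := h3
      exact h4.trans hkey
    calc W * |E17| ≤ W * (3 * π * c * K₁ * ll ^ 2) := mul_le_mul_of_nonneg_left hE17b hW0.le
      _ ≤ W * (η' * Φq * Real.log L) := mul_le_mul_of_nonneg_left h1 hW0.le
      _ = η' * (W * Φq * Real.log L) := by ring
  -- bound for Rpp ("the contribution from prime powers is negligible")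
  have hRppb : |Rpp| ≤ 21 * π * c * M ^ 2 := by
    have h := nonprime_part_le hc hT1 hL1 ρ χ hM0 (fun n => hM q n (by omega)) hNL
    calc |Rpp| ≤ 7 * (π * c / Real.log T) * M ^ 2 * (1 + Real.log L) := h
      _ = 7 * π * c * M ^ 2 * ((1 + Real.log L) / Real.log T) := by ring
      _ ≤ 7 * π * c * M ^ 2 * 3 := by
          have h1 : (1 + Real.log L) / Real.log T ≤ 3 := by
            rw [div_le_iff₀ hlogT0]; linarith only [hlogL1, hLT, hlogT0]
          exact mul_le_mul_of_nonneg_left h1 (by positivity)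
      _ = 21 * π * c * M ^ 2 := by ring
  have hb4 : W * |Rpp| ≤ η' * scaleS w B ρ q := by
    rw [hS]
    have h1 : 21 * π * c * M ^ 2 ≤ η' * Φq * Real.log L := by
      have h2 : (21 * π * c * M ^ 2 + 1) * ll ^ 1 ≤ 2 * η' * δφ * Real.log q := by
        have hKp : (0 : ℝ) < 21 * π * c * M ^ 2 + 1 := by positivity
        have := mul_le_mul_of_nonneg_left hB' hKp.le
        rwa [mul_div_mul_cancel_aux hKp.ne'] at this
      have h3 : 21 * π * c * M ^ 2 * ll ≤ 2 * η' * δφ * Real.log q := by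
        rw [pow_one] at h2; linarith only [h2, hll0]
      have h4 : 21 * π * c * M ^ 2 ≤ η' * (δφ / ll) * (2 * Real.log q) := by
        rw [show η' * (δφ / ll) * (2 * Real.log q) = 2 * η' * δφ * Real.log q / ll by ring]
        rw [le_div_iff₀ hll0]
        exact h3
      exact h4.trans hkey
    calc W * |Rpp| ≤ W * (21 * π * c * M ^ 2) := mul_le_mul_of_nonneg_left hRppb hW0.le
      _ ≤ W * (η' * Φq * Real.log L) := mul_le_mul_of_nonneg_left h1 hW0.le
      _ = η' * (W * Φq * Real.log L) := by ring
  -- bound for Bad ("it then remains to justify replacing χ(p) by −1")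
  have hpcT : 0 ≤ π * c / Real.log T := div_nonneg (by positivity) hlogT0.le
  have hBadb : |Bad| ≤ KG * (π * c / Real.log T) * (ll + Real.log 4 + 1) +
      KG * (π * c / Real.log T) * (2 * (C3 * Real.log q / Real.sqrt (Real.log E))) := by
    have h1 : |Bad| ≤ KG * ∑ p ∈ P, (x p + 1) * |s p| / p := by
      calc |Bad| ≤ ∑ p ∈ P, |(x p + 1) * s p * cG ρ.G₀ (u p) / p| := abs_sum_le_sum_abs _ _
        _ ≤ ∑ p ∈ P, KG * ((x p + 1) * |s p| / p) := by
            refine sum_le_sum fun p hp => ?_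
            have hpp := hPprime p hp
            have hp0 : (0 : ℝ) < p := by exact_mod_cast hpp.pos
            have hx0 : 0 ≤ x p + 1 := by
              have := (abs_le.mp ((Complex.abs_re_le_norm _).trans
                (χ.norm_le_one (p : ZMod q)))).1
              simp only [hx]; linarith only [this]
            have hup : u p ∈ Set.Icc (0 : ℝ) 1 := by
              simp only [hu]
              have hlp : 0 ≤ Real.log p := Real.log_nonneg (by exact_mod_cast hpp.one_lt.le)
              have hlpL : Real.log p ≤ Real.log L := Real.log_le_log hp0 (hPle p hp)
              exact ⟨div_nonneg hlp hlogL0.le, div_le_one_of_le₀ hlpL hlogL0.le⟩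
            have hcg := hKG (u p) hup
            rw [abs_div, abs_mul, abs_mul, abs_of_nonneg hx0, abs_of_pos hp0, div_le_iff₀ hp0]
            calc (x p + 1) * |s p| * |cG ρ.G₀ (u p)| ≤ (x p + 1) * |s p| * KG :=
                  mul_le_mul_of_nonneg_left hcg (mul_nonneg hx0 (abs_nonneg _))
              _ = KG * ((x p + 1) * |s p| / p) * p := by
                  rw [mul_div_assoc', div_mul_cancel₀ _ hp0.ne']; ring
        _ = KG * ∑ p ∈ P, (x p + 1) * |s p| / p := by rw [mul_sum]
    have h2 := badPrimes_le hc hT1 hq3 hχq hN500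
    have h3 : ∑ p ∈ P, (x p + 1) * |s p| / p ≤ π * c / Real.log T * ((ll + Real.log 4 + 1) +
        2 * (C3 * Real.log q / Real.sqrt (Real.log E))) := by
      refine h2.trans (mul_le_mul_of_nonneg_left (add_le_add le_rfl ?_) hpcT)
      exact mul_le_mul_of_nonneg_left h3q (by norm_num)
    calc |Bad| ≤ KG * ∑ p ∈ P, (x p + 1) * |s p| / p := h1
      _ ≤ KG * (π * c / Real.log T * ((ll + Real.log 4 + 1) +
          2 * (C3 * Real.log q / Real.sqrt (Real.log E)))) := mul_le_mul_of_nonneg_left h3 hKG0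
      _ = _ := by ring
  have hb2 : W * Φq * Real.log L * |Bad| ≤
      η' * scaleS w B ρ q + π * c * KG * C3 / Real.sqrt (Real.log E) * scaleS w B ρ q := by
    rw [hS]
    -- the `p ∣ q` part is `o(1)`
    have h1 : KG * (π * c / Real.log T) * (ll + Real.log 4 + 1) ≤ η' := by
      have h2 : (KG * π * c + 1) * ll ≤ η' * Real.log q := by
        have hKp : (0 : ℝ) < KG * π * c + 1 := by positivity
        have := mul_le_mul_of_nonneg_left hC' hKp.le
        rw [pow_one, mul_div_mul_cancel_aux hKp.ne'] at this
        exact this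
      have h3 : 3 * (KG * π * c + 1) ≤ η' * Real.log q := by
        have hKp : (0 : ℝ) < 3 * (KG * π * c + 1) := by positivity
        have := mul_le_mul_of_nonneg_left hD' hKp.le
        rw [pow_zero, mul_one, mul_div_mul_cancel_aux hKp.ne'] at this
        exact this
      have hKpc : 0 ≤ KG * π * c := by positivity
      have h4a : KG * π * c * Real.log 4 ≤ KG * π * c * 2 := mul_le_mul_of_nonneg_left hlog4 hKpc
      have h4 : KG * π * c * (ll + Real.log 4 + 1) ≤ 2 * η' * Real.log q := by
        have hll' : 0 ≤ ll := hll0.le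
        nlinarith only [h2, h3, h4a, hKpc, hll']
      have h5a := mul_le_mul_of_nonneg_left hlogT2 hη'0.le
      have h5 : KG * π * c * (ll + Real.log 4 + 1) ≤ η' * Real.log T := by
        linarith only [h4, h5a]
      rw [show KG * (π * c / Real.log T) * (ll + Real.log 4 + 1) =
        KG * π * c * (ll + Real.log 4 + 1) / Real.log T by ring, div_le_iff₀ hlogT0]
      exact h5
    -- the `χ(p) = 1` part is `O(1/√log E)`
    have h2 : KG * (π * c / Real.log T) * (2 * (C3 * Real.log q / Real.sqrt (Real.log E))) ≤
        π * c * KG * C3 / Real.sqrt (Real.log E) := by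
      rw [show KG * (π * c / Real.log T) * (2 * (C3 * Real.log q / Real.sqrt (Real.log E))) =
        π * c * KG * C3 / Real.sqrt (Real.log E) * (2 * Real.log q / Real.log T) by
          field_simp]
      have h3 : 2 * Real.log q / Real.log T ≤ 1 := (div_le_one hlogT0).mpr hlogT2
      calc π * c * KG * C3 / Real.sqrt (Real.log E) * (2 * Real.log q / Real.log T)
          ≤ π * c * KG * C3 / Real.sqrt (Real.log E) * 1 :=
            mul_le_mul_of_nonneg_left h3 (by positivity)
        _ = _ := mul_one _
    calc W * Φq * Real.log L * |Bad|
        ≤ W * Φq * Real.log L * (KG * (π * c / Real.log T) * (ll + Real.log 4 + 1) +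
            KG * (π * c / Real.log T) * (2 * (C3 * Real.log q / Real.sqrt (Real.log E)))) :=
          mul_le_mul_of_nonneg_left hBadb hWΦL0
      _ ≤ W * Φq * Real.log L * (η' + π * c * KG * C3 / Real.sqrt (Real.log E)) :=
          mul_le_mul_of_nonneg_left (add_le_add h1 h2) hWΦL0
      _ = _ := by ring
  have hb1 : W * Φq * Real.log L * |S18 - Isin| ≤ η' * scaleS w B ρ q := by
    rw [hS]
    calc W * Φq * Real.log L * |S18 - Isin| ≤ W * Φq * Real.log L * η' :=
          mul_le_mul_of_nonneg_left h18P hWΦL0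
      _ = _ := by ring
  -- assembly
  have habs : |diagD c w B ρ χ + Jmain c w B ρ q| ≤
      W * Φq * Real.log L * |S18 - Isin| + W * Φq * Real.log L * |Bad| + W * |E17| + W * |Rpp| := by
    rw [hfinal]
    have t1 := abs_add_le
      (W * Φq * Real.log L * (-(S18 - Isin)) + W * Φq * Real.log L * Bad + W * E17) (W * Rpp)
    have t2 := abs_add_le (W * Φq * Real.log L * (-(S18 - Isin)) + W * Φq * Real.log L * Bad) (W * E17)
    have t3 := abs_add_le (W * Φq * Real.log L * (-(S18 - Isin))) (W * Φq * Real.log L * Bad)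
    have e1 : |W * Φq * Real.log L * (-(S18 - Isin))| = W * Φq * Real.log L * |S18 - Isin| := by
      rw [abs_mul, abs_neg, abs_of_nonneg hWΦL0]
    have e2 : |W * Φq * Real.log L * Bad| = W * Φq * Real.log L * |Bad| := by
      rw [abs_mul, abs_of_nonneg hWΦL0]
    have e3 : |W * E17| = W * |E17| := by rw [abs_mul, abs_of_pos hW0]
    have e4 : |W * Rpp| = W * |Rpp| := by rw [abs_mul, abs_of_pos hW0]
    linarith only [t1, t2, t3, e1, e2, e3, e4]
  calc |diagD c w B ρ χ + Jmain c w B ρ q|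
      ≤ W * Φq * Real.log L * |S18 - Isin| + W * Φq * Real.log L * |Bad| + W * |E17| + W * |Rpp| := habs
    _ ≤ η' * scaleS w B ρ q + (η' * scaleS w B ρ q +
          π * c * KG * C3 / Real.sqrt (Real.log E) * scaleS w B ρ q) +
        η' * scaleS w B ρ q + η' * scaleS w B ρ q :=
      add_le_add (add_le_add (add_le_add hb1 hb2) hb3) hb4
    _ = (η + π * c * KG * C3 / Real.sqrt (Real.log E)) * scaleS w B ρ q := by
      rw [hη']; ring

/-- **Proposition 5 ⇐ (17) + Proposition 3** (with (18) = `eq18_holds` and (3) = the sibling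
`cPhi_pos_holds`, `weightHat_zero_holds`): BH26:Prop5 is a theorem MODULO the named facts `eq17`
(the inner `m`-sum, an Euler–Maclaurin computation) and `prop3` (Heath-Brown's Lemma 3) only.
PROVED along the printed proof (§5, pp. 13–14). [cite: BondarenkoHeap2026, Proposition 5 (proof, §5 pp. 13–14)] -/
theorem prop5_of_eq17_prop3 (h17 : eq17) (h3 : prop3) : prop5 :=
  prop5_of_eq17_prop3_aux h17 h3 eq18_holds cPhi_pos_holds weightHat_zero_holds fun G₀ =>
    let ⟨K, hK0, hKb, _⟩ := cG_bound_lipschitz G₀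
    ⟨K, hK0, hKb⟩

/-- **Theorem 4 ⇐ (17) + Proposition 3 + Proposition 6** ("Combining these two propositions gives
Theorem 4", §5 p. 13), through `prop5_of_eq17_prop3` and the statement file's
`theorem4_of_prop5_prop6`, with (3) discharged by the sibling `Section2Proofs`.
[cite: BondarenkoHeap2026, Theorem 4 (proof: Propositions 5 and 6)] -/
theorem theorem4_of_eq17_prop3_prop6 (h17 : eq17) (h3 : prop3) (h6 : prop6) : theorem4 :=
  theorem4_of_prop5_prop6 (prop5_of_eq17_prop3 h17 h3) h6 cPhi_pos_holds weightHat_zero_holds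

end Prop5Proof


end Literature.NumberTheory.LFunctions.BondarenkoHeap2026
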